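import Mathlib
import HarnessLib
import HarnessLib.Audit
import Summits.AtomisticToContinuum.Statement
import Literature.MathematicalPhysics.KineticTheory.RegularStationaryState
import Literature.Dynamics.Billiards.InfiniteVolumePesinDefect
import Literature.Analysis.FluidPDE.InfiniteHardSphereDynamics
import Literature.Analysis.FluidPDE.PalmLocalState
import Summits.AtomisticToContinuum.HydrodynamicLimit.Theorems.TwoClocksEntropyToHydro
import Summits.AtomisticToContinuum.HydrodynamicLimit.Theorems.SuperextensiveClosureCostGibbsInvariance
import Summits.AtomisticToContinuum.HydrodynamicLimit.Theorems.SuperextensiveClosureCostTransferInequality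
import HarnessLib.Audit.Status.Attr

/-!
Route: PesinPricing

DORMANT since 2026-08-24T17:42:54Z (reconciler: no traction for 6.9 d (last activity item-evidence-added at 2026-08-17T18:29:49Z); parked, not closed — `ledger route dormant route-AtomisticToContinuum-PesinPricing --off` to reactivate) — unstaffed, not closed; items shared with open routes are served there. `ledger route dormant <id> --off` reactivates.

# Route PesinPricing — u-regularity is priced, not inherited — an N-uniform upper volume lemma plus
the Kifer–Young Pesin-defect rate make every sustainable local state Pesin-saturating, hence
u-Gibbs, hence Gibbs

X_P = V ∧ KY ∧ R ("it suffices to show"), realising card pesin-defect-prices-u-regularity (spine);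
conforming successor of the retired route PesinDefectPricing; D-0027 §2.1 deciding theorem since the
2026-08-16 route-choice (crux-only form, gen-2):
`closes : UpperVolumeLemma → KiferYoungUpperR → PesinSaturationRigidityR → PricingGlue →
EnergyCurrentTails → GronwallU → HydrodynamicLimit` (gen-3 form, 2026-08-16T09:24Z, rev 45,
certified native; RE-ELABORATED 2026-08-16 after the statement re-type p126922 — `HydrodynamicLimit`
is now the PACKING-GUARDED d = 3 limit — by post-composing with the registry bridge
`HydrodynamicLimit.of_unguarded`, same six hypotheses) — hypotheses = the route's six cruxes and
nothing else; the pricing output PricedBoltzmannProperty (14419) and the shared target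
RelEntropyVanishing (0766) are DERIVED inside the decision (PricingGlue V KY R, then GronwallU ·
EnergyCurrentTails), not assumed, and the entropy-inequality step RelEntropyVanishing ⇒ Statement is
the LANDED theorem Theorems.hydrodynamicLimit_of_relEntropyVanishing (p85039,
Theorems/TwoClocksEntropyToHydro.lean, imported since rev 44) invoked inside the proof term — the
former glue item EntropyToHydro (0769) is no longer a hypothesis and was dropped from this route
(rev 46).
ROUTE-CHOICE 2026-08-16 (operator hold crux-cap: the gate backfill found RelEntropyVanishing an
underived hypothesis of the old `closes : RelEntropyVanishing → EntropyToHydro → HydrodynamicLimit`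
and its auto-crux would have made 8 > 7 cruxes; the one option offered, (a) split the thesis into
two routes, is taken): THIS route is the DYNAMIC-pricing thesis only (positive Pesin defect is
unaffordable); the STATIC price of the collisionless phase — CollisionlessStaticPrice (stmt-14089,
the repaired ZeroExponentPhase (ii)) with its placeholder glue PricingChainGlue (stmt-14105) — is
split off to the route that already carries exactly that thesis, the open
route-AtomisticToContinuum-CornersLogPrice (card collisionless-corners-log-price: LogPersistenceCost
12326, CollisionInevitability 12327, CollisionlessCornerCost 12328); no new route is opened under
the planning freeze (hand-over note on 14089 and on that route). GEN-2 COMPLETION (same hold, 04:14Z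
recount '8 cruxes > 7 after auto-crux of underived hypotheses': the two glue SUPPORTS GronwallU,
EntropyToHydro were hypotheses of the step-1 `closes`, and D-0027 §2.1 kinds every unproved
hypothesis of the deciding theorem crux): the deciding theorem is made CRUX-ONLY at exactly the cap
— PricingGlue restated without its unused EntropyPerParticle antecedent (stmt-14643) and badged crux
with GronwallU (14536) and EntropyToHydro (0769); EntropyPerParticle (9427, the tooth, off the
chain) becomes a support, PricedBoltzmannProperty (14419, the pricing output, now derived) an
intermediate target and RelEntropyVanishing (0766, derived) the target again; 7 cruxes V, KY, R,
PricingGlue, EnergyCurrentTails, GronwallU, EntropyToHydro — 6 once the provable-now EntropyToHydro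
lands (candidate proof on 0769). GEN-3 (route-repair badge, 2026-08-16T09:2xZ): EntropyToHydro HAS
landed (p85039, 06:20Z) — `closes` re-supplied with the entropy step discharged by the landed
theorem, 6 cruxes = its 6 hypotheses, 0769 dropped from this route, 12 items. It is the
PRICING decomposition of U1 of the (likewise retired) route UGibbsRigidity (URegularLimits,
stmt-AtomisticToContinuum-5102/5478) and
re-wants, by identical signature, the typed target (0766), the teeth (EntropyPerParticle 4276,
support here since gen-2) and the affordability budget
(TransferInequality 3924, GibbsInvariance 3926) of its retired siblings, so that their conforming
successors share them again.
V = UpperVolumeLemma (typed, finite N, rank 2): under the invariant homogeneous Gibbs law G_N of N+1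
spheres at reduced density σ < σ₀ the
measure of the initial data whose configurations (ε_N/16)-shadow a given orbit on [t₁,t₂] is ≤
exp(C(N+1) + C·#collisions − Λ) times
that of the kinematic reference set, Λ = Σ over non-grazing collisions of log(1 + |g|τ⁺/ε_N) (the
dilute-gas unstable Jacobian), C
INDEPENDENT OF N. KY = KiferYoungUpperR (stmt-13790, informal until defn-PalmLocalState /
defn-InfiniteVolumePesinDefect land, rank 3; the repaired
form C′ of the misstated KiferYoungUpper 9728, dropped rev 5): V upgrades by Young's counting to a
large-deviation upper bound, at
speed (N+1)^{4/3}(t₂−t₁) ≍ collisions in the window, for the particle-rooted space-time empirical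
local state R_N on the conserved
energy-cut event 𝖤(z) ≤ e₀(N+1), over ALL weakly closed sets 𝒜 of rooted laws, with rate c·inf over
𝒜 ∩ 𝓛(σ,e₀) (Palm laws of
translation-invariant intensity-σ³ hard-core states stationary under the infinite flow, E|v_root|²/2
≤ e₀; inf ∅ = +∞) of the Pesin
defect density i = (λ⁺ − h)/σ³ per particle per unit MICROSCOPIC time (Galilean-invariant,
1-homogeneous, 0 on drifted Gibbs states). R = PesinSaturationRigidityR (stmt-13806,
informal until defn-InfiniteVolumePesinDefect lands, rank 4; the repaired form C′(a) of the
misstated PesinSaturationRigidity 9729,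
dropped rev 7): stationary, translation-invariant, SPATIALLY ERGODIC states of density in (0, η₀),
entropy-regular w.r.t. some dilute
Gibbs state, with i = 0 are u-regular (infinite-volume Ledrappier–Young) hence, by URigidity
(stmt-5572), Gibbs — with the mixture
corollary (per-component density bound, activity z = 0 admitted) that the one-block step consumes;
the quantitative Pesin gap PesinGap (stmt-13807, informal, rank 6, MOOTED 2026-08-16T03:26Z by a
concurrent seat — off the deciding chain, record kept on the item; repaired C′(b): ergodic form with
density floor, energy cap, third velocity
moment, entropy budget w.r.t. a dilute reference). Affordability then forces every macroscopically
sustained local state to be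
Pesin-saturating, so the Boltzmann property holds FOR THE STATES THAT OCCUR, dilute part
(PricedBoltzmannProperty, stmt-14419, derived from V, KY, R by the glue crux PricingGlue), which is
all the
one-block step consumes (GronwallU, stmt-14536, with the velocity-tail crux EnergyCurrentTails
stmt-9235) ⇒ RelEntropyVanishing (0766) ⇒ the unguarded hydrodynamic limit by the landed
entropy-inequality theorem Theorems.hydrodynamicLimit_of_relEntropyVanishing
(p85039; the content of the shared glue item 0769, dropped from this route rev 46 once discharged
inside `closes`) ⇒ HydrodynamicLimit (packing-guarded since the 2026-08-16 re-type p126922) by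
`HydrodynamicLimit.of_unguarded`.
Lean: `∀ (a₀ θ₀ : Literature.MathematicalPhysics.KineticTheory.T3 → ℝ) (u₀ :
Literature.MathematicalPhysics.KineticTheory.T3 → Literature.MathematicalPhysics.KineticTheory.V3),
Continuous a₀ → Continuous θ₀ → Continuous u₀ → (∀ x, 0 < a₀ x) → (∀ x, 0 < θ₀ x) → ∃ σ₀ : ℝ, 0 < σ₀
∧ ∀ σ : ℝ, 0 < σ → σ < σ₀ → ∀ (T : ℝ) (ρ θ : ℝ → Literature.MathematicalPhysics.KineticTheory.T3 →
ℝ) (u : ℝ → Literature.MathematicalPhysics.KineticTheory.T3 →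
Literature.MathematicalPhysics.KineticTheory.V3),
Literature.MathematicalPhysics.KineticTheory.IsHardSphereEulerSolution σ T ρ u θ → ∀ Φ : (N : ℕ) →
Literature.Analysis.FluidPDE.HardSphereFlow (Literature.Analysis.FluidPDE.Torus.geometry (Fin 3))
(Literature.MathematicalPhysics.KineticTheory.hsDiameter σ N) (N + 1), (∀ N,
MeasureTheory.IsProbabilityMeasure (Literature.MathematicalPhysics.KineticTheory.localGibbsLaw σ a₀
u₀ θ₀ N (Φ N))) ∧ (Literature.MathematicalPhysics.KineticTheory.TendstoHydroFieldsAt (fun N =>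
Literature.MathematicalPhysics.KineticTheory.localGibbsLaw σ a₀ u₀ θ₀ N (Φ N)) Φ ρ u θ 0 → ∀ t ∈
Set.Ico 0 T, ∃ a : Literature.MathematicalPhysics.KineticTheory.T3 → ℝ, (∀ N,
MeasureTheory.IsProbabilityMeasure (Literature.MathematicalPhysics.KineticTheory.localGibbsLaw σ a
(u t) (θ t) N (Φ N))) ∧ (∀ χ : Literature.MathematicalPhysics.KineticTheory.T3 → ℝ, Continuous χ → ∀
δ : ℝ, 0 < δ → ∃ C : ℝ, 0 < C ∧ ∀ N : ℕ, Literature.MathematicalPhysics.KineticTheory.localGibbsLaw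
σ a (u t) (θ t) N (Φ N) {z | δ < |Literature.MathematicalPhysics.KineticTheory.empiricalDensityField
z χ - ∫ x, χ x * ρ t x|} ≤ ENNReal.ofReal (C * Real.exp (-(C⁻¹ * (N + 1)))) ∧
Literature.MathematicalPhysics.KineticTheory.localGibbsLaw σ a (u t) (θ t) N (Φ N) {z | δ <
‖Literature.MathematicalPhysics.KineticTheory.empiricalMomentumField z χ - ∫ x, (χ x * ρ t x) • u t
x‖} ≤ ENNReal.ofReal (C * Real.exp (-(C⁻¹ * (N + 1)))) ∧
Literature.MathematicalPhysics.KineticTheory.localGibbsLaw σ a (u t) (θ t) N (Φ N) {z | δ <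
|Literature.MathematicalPhysics.KineticTheory.empiricalEnergyField z χ - ∫ x, χ x *
Literature.MathematicalPhysics.KineticTheory.totalEnergyDensity (ρ t x) (u t x) (θ t x)|} ≤
ENNReal.ofReal (C * Real.exp (-(C⁻¹ * (N + 1))))) ∧ Filter.Tendsto (fun N : ℕ =>
InformationTheory.klDiv ((Φ N).lawAt (Literature.MathematicalPhysics.KineticTheory.localGibbsLaw σ
a₀ u₀ θ₀ N (Φ N)) t) (Literature.MathematicalPhysics.KineticTheory.localGibbsLaw σ a (u t) (θ t) N
(Φ N)) / ((N : ENNReal) + 1)) Filter.atTop (nhds 0))`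

## Assembly
V (UpperVolumeLemma) → KY (KiferYoungUpperR, informal) gives, under G_N, the two-term cost law: a
local behaviour sustained on a patch of
N_P particles over [t₁,t₂] costs ≥ max{static deficit, c·(N+1)^{1/3}(t₂−t₁)·N_P·i(ν)};
TransferInequality + GibbsInvariance make
only O(N)-cost behaviours visible under local Gibbs data, so every OVY LIMIT STATE of the evolved
law (un-rooted frame, tree IsOVYLimitState; every T₀ > 0) is a zero-defect regular
stationary state under an equilibrium infinite flow and — by R (PesinSaturationRigidityR, mixture
corollary) — its DILUTE part
{a.s. density < η₀} is a Gibbs mixture (z = 0 admitted), NOTHING being claimed at density ≥ η₀: the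
typed PricedBoltzmannProperty
(stmt-14419; 2026-08-16 repair of the misstated informal glue PricedBoltzmannHypothesis 9730 — L1
rooted/Palm frame, L2 density scope,
energy cut); the one-block Gronwall GronwallU (stmt-14536, typed glue PricedBoltzmannProperty →
EnergyCurrentTails →
RelEntropyVanishing: velocity truncation by the shared crux EnergyCurrentTails stmt-9235,
dense-patch cutoff by the entropy inequality
against the dilute reference, virial identification and reference statics inside) yields the typed
target RelEntropyVanishing; the landed entropy-inequality theorem
Theorems.hydrodynamicLimit_of_relEntropyVanishing (p85039) turns it
into the UNGUARDED Literature conjecture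
`Literature.MathematicalPhysics.KineticTheory.HydrodynamicLimit`, and the registry bridge
`HydrodynamicLimit.of_unguarded` (Statement.lean, statement re-type p126922 of 2026-08-16: the
sub-problem Statement is now the packing-guarded d = 3 hard-sphere Euler limit, implied by the
unguarded one — the guard `∀ t ∈ Ico 0 T, ∀ x, ρ t x * σ ^ 3 < η₀` is simply discarded, so this
route needs no new item) into the sub-problem Statement. The DECIDING THEOREM (glue.lean,
sorry-free, pure logic; crux-only, gen-3 form 2026-08-16T09:24Z rev 45, re-elaborated after the
re-type, certified native):
`theorem closes (hV : UpperVolumeLemma) (hKY : KiferYoungUpperR) (hR : PesinSaturationRigidityR)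
(hPG : PricingGlue) (hT : EnergyCurrentTails) (hG : GronwallU) : HydrodynamicLimit :=
HydrodynamicLimit.of_unguarded (Theorems.hydrodynamicLimit_of_relEntropyVanishing (hG (hPG hV hKY
hR) hT))` — hypotheses = the three mechanism cruxes, the glue crux PricingGlue (stmt-14643:
UpperVolumeLemma → KiferYoungUpperR → PesinSaturationRigidityR → PricedBoltzmannProperty), the
shared velocity-tail crux and the glue crux GronwallU — all six cruxes of the route and nothing
else; conclusion = the Statement decl `HydrodynamicLimit`; PricedBoltzmannProperty and
RelEntropyVanishing are derived inside and the entropy step is the imported landed theorem (the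
former seventh hypothesis EntropyToHydro 0769, proved in the tree 2026-08-16T06:20Z, dropped from
this route rev 46). The Assembly item (stmt-14653, contentful by design) is the same chain with the
two glue cruxes discharged: UpperVolumeLemma → KiferYoungUpperR → PesinSaturationRigidityR →
EnergyCurrentTails → HydrodynamicLimit.

Rationale: WHY THIS LINE. The Kifer–Young large-deviation principle for hyperbolic systems (Young1990 Thm 1
upper bound: C² + a volume lemma, no hyperbolicity;
Kifer1990; towers: ReybelletYoung2008, MelbourneNicol2008; non-uniform expansion:
AraujoPacifico2006) has RATE = Pesin defect λ⁺ − h ≥ 0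
on invariant measures, vanishing exactly on u-Gibbs/SRB states (LedrappierYoung1985 Thm A,
BowenRuelle1975); its open-system twin is the
escape-rate formula γ = Σλ⁺ − h_KS (GaspardNicolis1990; Gaspard1998 §4.4 eq. (4.64) p. 145, volume
estimate (4.62)). Transplanted with
an explicit dictionary (orbit segment ↦ space-time patch of the N-sphere flow at fixed reduced
density; −log Jᵘ ↦ Σ_collisions
log(1 + |g|τ/ε), the dilute-gas clock model VanzonVanbeijerenDellago1998, VanbeijerenEtAl1997; Bowen
ball ↦ configuration tube) and
combined with the board's affordability device (Cauchy–Schwarz against the invariant Gibbs law,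
TransferInequality of route
SpacetimeExtensivity), it turns the weakest link of UGibbsRigidity — u-regularity of local limits
INHERITED along the non-equilibrium
flow with N-uniform distortion control — into an invoice: non-u-regular behaviour is not forbidden,
it is unaffordable (dynamical price
≍ N^{4/3}·t·i against an O(N) budget), and only an UPPER volume bound is imported (no lower bounds,
no holonomy, no Markov partition, no
mixing rate). Imported area: smooth ergodic theory / thermodynamic formalism (volume lemma, Pesin
defect, Ledrappier–Young) into the
OVY relative-entropy architecture (OllaVaradhanYau1993 §4, KipnisLandim1999 Ch. 6). Versus routes on
file (all three retired in the 2026-08-15 D-0027 audit; ids name their records): UGibbsRigidity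
filed the
inheritance inputs (TemperedCollisions 4275, CollisionMoments 4277) and reserved this decomposition
without filing it; RelEntropyErgodic
asked the classification for ALL finite-entropy states (0779); SpacetimeExtensivity posited
super-extensive closure costs (3921/3923)
with no mechanism — here they are the i > 0 branch of a two-term cost law; no item on the board
states a volume lemma or a
Pesin-defect rate; negatives index empty.

RANKED CRUXES. #0 RelEntropyVanishing (target) — Yau's relative-entropy form of the limit (shared
target of RelEntropyErgodic / UGibbsRigidity / KineticWindows / …, stmt-AtomisticToContinuum-0766):
∀ profiles ∃ σ₀ ∀ σ < σ₀ ∀ classical hs-Euler solutions on [0,T) ∀ flows, the local Gibbs laws are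
probability measures and, given the LLN at t = 0, for every t < T there is an activity profile a_t
whose local Gibbs law concentrates exponentially around (ρ, ρu, E)(t) and H(f^N_t | localGibbs(a_t,
u_t, θ_t))/(N+1) → 0. Reached here as V → KY → R → PricingGlue (stmt-14643, glue crux) ⊢
PricedBoltzmannProperty (stmt-14419, typed 2026-08-16, intermediate target = derived output) →
GronwallU (stmt-14536, glue crux PricedBoltzmannProperty → EnergyCurrentTails → RelEntropyVanishing,
with the shared velocity-tail crux EnergyCurrentTails stmt-9235) → this; the landed theorem
Theorems.hydrodynamicLimit_of_relEntropyVanishing (p85039; formerly the glue item EntropyToHydro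
0769, dropped from this route rev 46) then gives the sub-problem Statement inside `closes`. Since
the 2026-08-16 route-choice it is NOT a hypothesis of `closes` (the backfill flagged it
underived-target when it was): the crux-only `closes` (gen-3 form, rev 45) consumes V, KY, R,
PricingGlue, EnergyCurrentTails, GronwallU and derives it as GronwallU (PricingGlue hV hKY hR) hT.
(why it might fail: entropy production ≥ cN before the first shock for some smooth data kills every
entropy route; or sustained local states are Pesin-saturating yet non-Gibbs
(¬PesinSaturationRigidity), leaving the one-block step without an ergodic theorem.)
[OllaVaradhanYau1993, Yau1991, Spohn1991, KipnisLandim1999]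
#2 UpperVolumeLemma (crux) — N-UNIFORM UPPER VOLUME LEMMA (card crux 1, global form). There is σ₀
such that for σ < σ₀ and θe > 0 there is C with, for ALL N, all hard-sphere flows Φ of N+1 spheres
of diameter ε = ε_N on 𝕋³, all windows t₁ < t₂ and G_N-a.e. z (G_N = localGibbsLaw σ 1 0 θe, the
invariant homogeneous canonical Gibbs law): G_N{z′ : every particle of Φ_s z′ stays within torus
distance ε/16 of the same particle of Φ_s z for all s ∈ [t₁,t₂]} ≤ exp(C(N+1) + C·K − Λ) · G_N{z′ :
at time t₁ positions within ε/16 and velocities within ε/(8·(first collision time of that particle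
after t₁, capped at t₂, minus t₁))}, where K = number of collisions of the orbit of z in [t₁,t₂] and
Λ = Σ over its NON-GRAZING collisions (|cos φ| ≥ 1/2, i.e. ε|g| ≤ 2|⟨x_i − x_j, g⟩|) of log(1 +
|g|·τ⁺/ε), g the relative velocity of the pair and τ⁺ the time to the next collision involving
either partner (capped at t₂). One transverse power only and τ⁺ cut at either partner's next
collision are deliberate undercharges (true clock-model exponent: 2 per collision); e^{C·K} absorbs
O(1) per collision, e^{C(N+1)} the first/last flights. [difficulty: L] (why it might fail: the tube
measure must factor over collisions with O(1) distortion PER COLLISION uniformly in N (6N dims):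
earlier grazing/near-simultaneous collisions may focus the conditional law of later impact offsets
below scale ε²/(|g|τ⁺); no N-uniform growth lemma exists even for N discs (BalintEtAl2002).)
[Young1990, BowenRuelle1975, ChernovDolgopyat2009, BalintEtAl2002, SinaiChernov1987,
VanzonVanbeijerenDellago1998, Gaspard1998]
#3 KiferYoungUpperR (crux; stmt-13790, TYPED 2026-08-16 over defn-PalmLocalState /
defn-InfiniteVolumePesinDefect) — the Kifer–Young large-deviation upper bound for the
particle-rooted local state R_N at speed (N+1)^{4/3}(t₂−t₁) with rate c·inf of the Pesin defect over
𝒜 ∩ 𝓛(σ,e₀) (statement KY of the thesis; why/sources on the item). [Young1990, Kifer1990,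
OllaVaradhanYau1993, Alexander1976]
#4 PesinSaturationRigidityR (crux; stmt-13806, TYPED 2026-08-16) — spatially ergodic regular dilute
stationary states with zero Pesin defect are Gibbs (statement R of the thesis; infinite-volume
Ledrappier–Young + URigidity; why/sources on the item). [LedrappierYoung1985, NachtergaeleYau2003,
OllaVaradhanYau1993]
#5 EntropyPerParticle (SUPPORT since the 2026-08-16 route-choice gen-2 — off the deciding chain,
never a premise of PricingGlue/GronwallU; tenure decision now that EntropyToHydro has left the chain
(gen-3): re-badge it crux r5 only together with a restate that makes it an antecedent actually used
by PricingGlue, else the crux-only audit reports glue.unused-crux) — POSITIVE DYNAMICAL ENTROPY PER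
PARTICLE PER COLLISION, N-UNIFORM (shared with route UGibbsRigidity, stmt-AtomisticToContinuum-4276;
the teeth of pricing: if the entropy — equivalently, by the Pesin formula for the smooth invariant
law at finite N, the positive-Lyapunov sum — per collision tended to 0 along N → ∞, the Pesin-defect
rate would price nothing): there is σ₀ such that for σ < σ₀ there is c > 0 with, for all N ≥ 1 and
all flows Φ, a finite measurable partition whose Kolmogorov–Sinai entropy rate under the equilibrium
Gibbs law (activity 1, drift 0, temperature 1) for the macroscopic time-one map Φ₁ is ≥ c
(N+1)^{4/3} = c′ × (collisions per unit macroscopic time). The averaged shadow of UpperVolumeLemma's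
expansion half (E_G Λ ≍ (N+1)^{4/3}(t₂−t₁) log(1/σ³)). [difficulty: L] (why it might fail:
Wojtkowski1988 (pp. 133–134) gets only ~√N·(rate): cone/Q-form methods measure each collision
against the SYSTEM's previous collision (time ~1/(Nν)), not the particle's (~1/ν); an N-uniform
bound needs per-particle locality of expansion — the same wall as UpperVolumeLemma.)
[Wojtkowski1988, SinaiChernov1987, Chernov1997, VanbeijerenEtAl1997, LedrappierYoung1985]
#7 EnergyCurrentTails (crux; shared item stmt-AtomisticToContinuum-9235 of WarmColdDichotomy /
AnosovDiceHopf / TwoClocks / JaynesSqueeze / …, re-wanted here 2026-08-16) — N-UNIFORM INTEGRABILITY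
OF THE CUBIC VELOCITY MOMENT ALONG THE EVOLUTION: for hydrodynamic local Gibbs data and t < T, ∀ε
∃M,N₀ ∀N ≥ N₀ ∀s ≤ t: E[(N+1)⁻¹ Σ_i 1{|v_i(s)| > M}|v_i(s)|³] ≤ ε — the one input of GronwallU that
pricing does not deliver (the energy current has no exponential moments under the Maxwellian
reference; HighMomentumCutoffBarrier: OVY modified the kinetic energy instead). (why it might fail:
conservation + O(N) entropy allow a vanishing fraction of spheres at speed ≍ N^{1/2}; no N-uniform
Povzner / maximum principle for deterministic hard spheres.) [OllaVaradhanYau1993,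
NachtergaeleYau2003, Spohn1991]
#9 PricedBoltzmannProperty (INTERMEDIATE TARGET since gen-2, kind target: derived inside `closes` as
PricingGlue hV hKY hR, not a hypothesis, claimable directly at low priority; stmt-14419 = the 1:1
typed restate of the refuted-misstated informal glue PricedBoltzmannHypothesis 9730) — THE PRICING
OUTPUT in OVY's un-rooted frame: ∃η₀ ∀profiles ∃σ₀ ∀σ<σ₀ ∃e₀ ∀T₀>0 ∀flows, every OVY limit state
(IsOVYLimitState) has intensity σ³, kinetic energy density ≤ e₀, is entropy-regular w.r.t. a dilute
Gibbs state (0 < z ≤ 2σ³), is a RegularStationaryState of an equilibrium translation-covariant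
infinite flow with infPesinDefect = 0, and its dilute part {a.s. density < η₀}, normalised, is a
mixture of Gibbs laws with z ≥ 0 (nothing at density ≥ η₀: the static budget affords dense
equilibrated patches on a particle fraction ≈ C/log(1/σ³)). Proof route KY (13790) +
TransferInequality + energy cut + DefectRate (good rate function) + Palm inversion for (i)–(iii), R
(13806 a′) + ComponentLemma for (iv). (why it might fail: DefectRate, infinite dynamics on non-Gibbs
limit states, ¬13806.) [OllaVaradhanYau1993, Young1990, Kifer1990, KipnisLandim1999, Alexander1976]
#9 GronwallU (GLUE CRUX since gen-2 — hypothesis of the crux-only `closes`; stmt-14536, typed glue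
PricedBoltzmannProperty → EnergyCurrentTails → RelEntropyVanishing) — Yau's relative-entropy
Gronwall for the deterministic dilute gas: velocity truncation by EnergyCurrentTails, DENSE-PATCH
CUTOFF at blown-up density η₀ by the entropy inequality against the dilute reference (#dense ≤
H_N(t)/(c log(1/σ³)) + o(N), the analogue of KipnisLandim1999 Lemma 5.4.1), one-block for the dilute
part through the OVY limit states, virial identification (fluxDefect of dilute Gibbs states = 0,
thermodynamic = virial pressure) and the reference statics (activity inversion, exponential
concentration) proved inside. (why it might fail: noiseless OVY is unprinted — the dense-patch
cutoff needs the per-dense-particle contribution to ∂ₜH_N bounded after velocity truncation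
(impulsive collisional transfer), the pricing output says nothing at density ≥ η₀, and the EOS
inversion needs ρσ³ inside the analyticity radius.) [OllaVaradhanYau1993, Yau1991, KipnisLandim1999,
Spohn1991, Ruelle1969, NachtergaeleYau2003]
#9 PricingGlue (GLUE CRUX since gen-2; stmt-14643 = the 1:1 restate, WITHOUT the unused
EntropyPerParticle antecedent, of stmt-14564 filed 2026-08-16T03:53Z by the badge seat) —
UpperVolumeLemma → KiferYoungUpperR → PesinSaturationRigidityR → PricedBoltzmannProperty: the
eight-step proof route of the pricing output (energy cut; transfer at time 0; KY on the cut event at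
speed (N+1)^{4/3}T₀ ≫ N; DefectRate = i a good rate function on 𝓛(σ,e₀), the one unprinted step;
barycentre + flow piecing; Palm inversion; static entropy budget; dilute part Gibbs by R +
ComponentLemma) — a hypothesis of the crux-only `closes`, so V, KY, R enter the deciding theorem
themselves; GibbsInvariance and TransferInequality are used as theorems, not carried as antecedents.
(why it might fail: DefectRate — i need not be a good rate function on 𝓛(σ,e₀): bounded-defect limit
laws may carry no infinite dynamics or λ⁺ may drop at grazing-heavy limits, so KY's closed-set bound
never localises to i(μ) = 0; and ergodic components of a stationary zero-defect state need not be
stationary.) [OllaVaradhanYau1993, Young1990, Kifer1990, Alexander1976, Mecke1967,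
LedrappierYoung1985]
SPLIT OFF 2026-08-16 (route-choice, crux-cap, option (a)): CollisionlessStaticPrice (stmt-14089,
crux r9, the repaired ZeroExponentPhase (ii): patch-local occupation-indexed collision inevitability
under G_N) and the placeholder PricingChainGlue (stmt-14105: UpperVolumeLemma → EntropyPerParticle →
CollisionlessStaticPrice → RelEntropyVanishing, never logic) — the STATIC pricing of the
collisionless phase is the thesis of route-AtomisticToContinuum-CornersLogPrice (LogPersistenceCost
12326 / CollisionInevitability 12327 / CollisionlessCornerCost 12328), the second route of the
split; both records (14089 with its crux-attack evidence and checked stamp) stay on the ledger and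
14089 can be re-wanted there verbatim.
#9 TransferInequality (support) — STATIC L² BUDGET = AFFORDABILITY (shared with route
SpacetimeExtensivity, stmt-AtomisticToContinuum-3924): for continuous positive profiles and θe with
θ₀ < 2θe pointwise, ∃ σ₀ ∀ σ < σ₀ ∃ C ∀ N, Φ and EVERY set S: localGibbsLaw σ a₀ u₀ θ₀ N Φ S ² ≤
e^{C(N+1)} · G_N(S) (Cauchy–Schwarz against the invariant law; an event of G_N-cost > C(N+1) per
unit is invisible under local Gibbs data at ALL times, by GibbsInvariance). [difficulty: M]
[KipnisLandim1999, BodineauGallagherSaintraymond2017, Ruelle1969]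
#9 GibbsInvariance (support) — the homogeneous canonical Gibbs law G_N = localGibbsLaw σ 1 0 θe N Φ
is preserved by Φ.flow t for every t (shared with route SpacetimeExtensivity,
stmt-AtomisticToContinuum-3926; Liouville invariance + energy conservation + conull good set). The
invariant reference law of the whole route: it makes the static term of the cost law
time-independent and is the measure of UpperVolumeLemma. [difficulty: provable-now] [Alexander1975,
CercignaniIllnerPulvirenti1994]
#— EntropyToHydro (stmt-0769; DROPPED from this route 2026-08-16 rev 46, route-repair badge gen-3):
PROVED in the tree (p85039, commit c80e2acdae90, Theorems/TwoClocksEntropyToHydro.lean: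
hydrodynamicLimit_of_relEntropyVanishing, entropyToHydro_proof); the deciding theorem now invokes
that theorem inside its proof term (import added rev 44), so the entropy-inequality glue
RelEntropyVanishing → HydrodynamicLimit is neither a hypothesis nor an item here; the shared item
stays wanted by its other routes. [KipnisLandim1999, OllaVaradhanYau1993, Yau1991]

TWO-LAYER PLAN. KiferYoungUpperR ⇐ LocalCounting (separated-set counting of patch histories fed by
UpperVolumeLemma realises the space-time entropy
DENSITY; boundary terms O(N^{-1/3}); ball version) → DefectLsc (i lower semicontinuous on 𝓛(σ,e₀):
entropy density u.s.c., λ⁺-density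
continuous given integrable log(1 + |g|τ/ε) near grazing — a TemperedCollisions 4275-type input) →
LimitPointsInClass (on the energy-cut
event every local-weak limit point of R_N lies in 𝓛(σ,e₀), super-exponentially surely at speed
N^{4/3}; the noiseless Palm analogue of
OVY Lemmas 4.1–4.3, incl. existence of the infinite dynamics on the limit state) → KiferYoungUpperR
(k = 3). PesinSaturationRigidityR ⇐
InfiniteVolumeLY (spatially ergodic, regular, 0 < density < η₀, i = 0 ⇒ u-regular on local unstable
plaques) → URigidity (u-regular
⇒ Gibbs; stmt-5572 of the retired UGibbsRigidity, re-filed here when typed) (k = 2); its mixture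
corollary (a′) ⇐ (a) +
ComponentLemma (a.e. spatially-ergodic component of a regular stationary zero-defect state with a.s.
density < η₀ is again
stationary, regular, dilute, zero-defect — affinity H4 of i and of specificRelEntropy; NOTE
component STATIONARITY is not automatic
for a general stationary translation-invariant law and is part of the lemma) — a support item once
13806 is typed. PesinGap (the
former third child; own crux rank 6 from 2026-08-15) was MOOTED 2026-08-16T03:26Z (record and
evidence on stmt-13807); if it returns it is support under R, its componentwise corollary routine
(Markov/Chebyshev, refuter gen-2
Scratch.lean m_componentwise_gap). UpperVolumeLemma ⇐ TwoBodyTube (one charged collision against a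
frozen environment: the factor
(1 + |g|τ⁺/ε)^{-1} with O(1) distortion on non-grazing cells) → TubeFactorisation (conditional laws
of successive impact offsets stay
spread at scale ε/16, N-uniformly) → UpperVolumeLemma (k = 2). PricingGlue ⇐ DefectRate (i a good
rate function on 𝓛(σ,e₀), step (4)) → PalmPiecing (barycentre, flow piecing, Palm inversion, static
budget: steps (5)–(7)) → ComponentLemma (step (8)) → PricingGlue (k = 3, foreseen; file when a
prover's census isolates (4)). GronwallU ⇐ ReferenceStatics (activity inversion + exponential
concentration, 0767/0768-type) → VirialIdentification (fluxDefect of dilute Gibbs states = 0,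
0782-type) → DenseCutoffGronwall (velocity truncation, dense-patch cutoff, one-block through the OVY
limit states, Gronwall) → GronwallU (k = 3, foreseen). Flux-level / static alternative assembly: NOT
this route since the 2026-08-16 split — the cost law with
PesinGap would give MomentumClosureCost / EnergyClosureCost (stmt-3921/3923 records; live in
SuperextensiveClosureCost / CornersLogPrice) with explicit rate
min{c N_P log N (static, collisionless corners: CornersLogPrice), c(δ)(N+1)^{4/3}(t₂−t₁)}. Nothing
of it is filed here.

KILL CRITERIA. ¬UpperVolumeLemma by a distortion blow-up GROWING WITH N (e.g. through the ≍ N^{5/3}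
global rate of near-simultaneous collisions) kills
the global lemma: PIVOT once to a patch-local volume lemma (restate UpperVolumeLemma for the
particles of a mesoscopic region with the
exterior as a boundary condition); if that is refuted too, close `refuted:UpperVolumeLemma`. A
COLLIDING ZERO-RATE CONSPIRACY — a
stationary translation-invariant finite-entropy state of the hard-sphere dynamics with collisions at
positive rate, i = 0 and
non-Euler flux (¬PesinSaturationRigidityR: a spatially ergodic, entropy-regular, dilute
counterexample — non-ergodic mixtures such as
½g_{z,+ue₁}+½g_{z,−ue₁} or ½g_{z₁}+½g_{z₂} are NOT counterexamples, they killed only the 9729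
wording) — closes the route
`refuted:PesinSaturationRigidityR` and kills UGibbsRigidity's URigidity with it; ¬PesinGap (item
mooted 03:26Z; a sequence of ergodic non-Gibbs
states with flux defect ≥ δ and i → 0) would retire only the flux-level alternative and the card's
crux 4, not this deciding chain; ¬CollisionlessStaticPrice (14089, split off 2026-08-16) no longer
touches this route at all. ¬EntropyPerParticle (support since gen-2, still the tooth: entropy per
collision → 0 at fixed σ) empties the rate of content and makes R untenable: close unless a
formalisation
artefact. ¬GronwallU as typed (a priced-Boltzmann, tail-controlled evolution whose relative entropy
still grows ≥ cN — necessarily through the dense fraction) kills the deciding chain but not the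
mechanism: repair by strengthening PricedBoltzmannProperty's density scope (η₀) or close
`refuted:GronwallU`. RelEntropyVanishing refuted (entropy production ≥ cN pre-shock) closes this and
every entropy route; so does ¬EnergyCurrentTails (heavy cubic velocity tails created pre-shock).
¬PricedBoltzmannProperty by an explicit OVY limit state with positive defect or with a non-Gibbs
dilute part refutes the pricing chain (then KY or R is false as typed): repair at the node the
witness names, else close `refuted:PricedBoltzmannProperty`. URegularLimits (5102)
proved by inheritance, or GibbsErgodicity (0779) proved, moots the route (superseded by the
conforming successors of UGibbsRigidity / RelEntropyErgodic).

NOT DECOMPOSED YET. The infinite-volume objects (Alexander flow defn-InfiniteHardSphereFlow,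
u-regular states defn-URegularState, Gibbs laws
defn-HardSphereGibbsState and the finite-N part of defn-PesinDefectDensity have LANDED; still open:
the Palm frame / local weak topology
defn-PalmLocalState and the infinite-volume defect density defn-InfiniteVolumePesinDefect, filed
2026-08-15 with the KY repair) — so KY and R
stay informal and unsplit; likewise PesinGap (also open, filed with the R repair:
defn-HardSphereFluxIntensities — fluxes, fluxDefect,
IsSpatiallyErgodic); the load-bearing normalisation H1 'i(g_{z,β,u}) = 0' (Pesin formula of the
equilibrium gas) becomes a support
statement if unprinted. OBSERVED GAP V → KY (for the tenure planner; not repaired here):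
UpperVolumeLemma as typed (tube radius ε/16
fixed, ONE transverse power, slack e^{C·K} with K ≍ a_N := (N+1)^{4/3}(t₂−t₁)) yields by counting
only the exponent
−a_N·[Λ̄(ν) − C·κ(ν) − h(ν)] (charge density minus O(1) per collision minus entropy density): an
ADDITIVE per-collision slack, not a
multiplicative c on i = λ⁺ − h — Young's γ(ε) → 0 has no analogue at fixed r/ε_N. Natural fix when V
is split
(TwoBodyTube/TubeFactorisation): tube radius r_N = η_N ε_N with η_N → 0 slowly (static reference
cost ≍ N log(1/η_N) = o(a_N)), so the
distortion per collision is O(η_N) → 0, plus the full two-power charge; otherwise KY prices only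
GROSS defects (i ≳ κ) and R would have
to classify 'nearly saturating' states, which no Ledrappier–Young argument does. Also left: the
patch-local version of V (only needed if the global one dies); the lower-semicontinuity lemma for i;
the Cesàro /
convexity bookkeeping passing 'i = 0' to OVY's averaged limit points (i is affine on
translation-invariant states); inside GronwallU (14536): the virial identification (0782-type,
fluxDefect of dilute Gibbs states = 0) and the reference statics (0767/0768-type) — the first
support statements to split off when a slot frees — while the large-velocity bound is now the shared
crux EnergyCurrentTails (9235); inside PricedBoltzmannProperty's proof route: DefectRate (i a good
rate function on the closed class 𝓛(σ,e₀)), the Palm inversion (PalmUniqueness) and the flow upgrade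
to an equilibrium flow, and the a.s. flow-invariance of the dilute event D (ComponentLemma side);
PesinGap (13807) and ZeroExponentPathwise (14090) were mooted 2026-08-16T03:26Z by a concurrent seat
(records on the items); the
retrodictions of the cost law (Galilean discount of collisionless corners, N_P log N static price,
one-long-corner — the last only as
a conjecture needing decorrelation under G_N, per the triage note); constants σ₀ (cluster-expansion
radius), c = c(σ,θe,e₀) in KY. CRUX BUDGET after the 2026-08-16 route-repair badge gen-3 (for
tenure): the deciding theorem is CRUX-ONLY — 6 cruxes = its 6 hypotheses (V 9426 r2, KY 13790 r3, R
13806 r4, EnergyCurrentTails 9235 r7, PricingGlue stmt-14643 r9, GronwallU 14536 r9) + targets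
RelEntropyVanishing 0766 (r0, derived; it still carries the gate's auto-crux record
'underived-target' of 04:02Z and may count toward the cap audit — budget conservatively as 7/7) and
PricedBoltzmannProperty 14419 (r9, intermediate, derived) + 3 supports (EntropyPerParticle 9427
tooth, GibbsInvariance 9239, TransferInequality 9512) + Assembly stmt-14653 = 12 items ≤ 15;
EntropyToHydro 0769 left rev 46 (landed p85039, invoked inside `closes`). At most ONE crux slot:
spend it on DefectRate if PricingGlue's prover censuses step (4), or on re-badging
EntropyPerParticle r5 together with a restate that makes it an antecedent actually used (else
glue.unused-crux). Deeper structure only by GLUED SPLITS of PricingGlue / GronwallU /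
KiferYoungUpperR as in the TWO-LAYER PLAN (children replace the parent in staffing; the parent stays
claimable), never by new free hypotheses of `closes` (each would count as a further crux). The
second route of the split remains route-AtomisticToContinuum-CornersLogPrice (static price); no new
route under the freeze.

CHEAPEST FALSIFIER. (i) TWO DISCS ON 𝕋² / TWO SPHERES ON 𝕋³ (N+1 = 2): UpperVolumeLemma reduces to a
tube estimate for one point particle in a periodic
array of one spherical scatterer (infinite-horizon periodic Lorentz gas); if the charged factor (1 +
|g|τ⁺/ε)^{-1} per non-grazing
collision fails THERE (astigmatism, BalintEtAl2002; infinite-horizon corridors), the dictionary is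
wrong before any N-uniformity —
refuters should test this first (growth lemmas for 3-D dispersing billiards, BalintToth2008). (ii)
NUMERICS (kit, not run here —
hub is compute-free and this is a one-shot planning seat): cloning / tube-sampling for N = 64…512
hard spheres at σ³ = 0.05: fit
log G_N(tube)/(reference) + Λ against C(N+1) + C·K and watch whether the fitted C drifts with N.
(iii) LOOKUP: an N-linear lower
bound h_N ≥ c·N·ν for the KS entropy of N hard balls at small packing in print (Chernov 2000
'Entropy values and entropy bounds',
acq-02322 of UGibbsRigidity) would make EntropyPerParticle `known`.

NUMBERS. Scaling (macroscopic units; N+1 spheres of diameter ε_N = σ(N+1)^{−1/3} on 𝕋³): collision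
rate per particle ν_N ≍ σ²√θ (N+1)^{1/3};
collisions in [t₁,t₂] K ≍ (N+1)^{4/3}(t₂−t₁); mean free path ℓ ≍ (N+1)^{-1/3}/σ², so |g|τ⁺/ε ≍ ℓ/ε ≍
σ^{-3} and the typical charge
per non-grazing collision is log(1 + ℓ/ε) ≍ 3 log(1/σ) (clock model: λ_max ≍ ν·ln(1/ñ), h_KS/N =
ν[−A ln ñ + B], ñ = nσ³,
VanbeijerenEtAl1997, VanzonVanbeijerenDellago1998; Chernov1997 for billiard entropy vs mean free
path); non-grazing fraction: cos φ has
flux density 2cos φ d(cos φ), so P(|cos φ| ≥ 1/2) = 3/4; hence E_G Λ ≍ (9/4)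
log(1/σ)·(N+1)^{4/3}(t₂−t₁) ≫ C·K for σ small —
the lemma has content iff C < (9/4)·log(1/σ), which fixes how small σ₀ must be. Tube arithmetic: r =
ε/16, pair offsets ≤ 2r = ε/8
< (1 − √3/2)ε ≈ 0.134ε, so tube members cannot skip a charged (|cos φ| ≥ 1/2, impact parameter ≤
0.866ε) collision. Budgets:
affordability O(N) (TransferInequality) vs dynamical price ≍ (N+1)^{4/3} t·i vs static price of
collisionless patches ≍ N_P log N
(card collisionless-corners-log-price C1). Known: h_N > 0 at each N (SinaiChernov1987);
Wojtkowski1988 lower bound ≍ √N only; LD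
upper bound with rate h − Σλ⁺ needs only C² + volume lemma (Young1990 Thm 1); escape rate = Σλ⁺ −
h_KS (Gaspard1998 (4.64)).
Items at open: 7 typed (target, 2 cruxes, 3 supports, assembly) + 4 informal filed right after open
(2 cruxes, 2 supports) = 11 ≤ 15; after the 2026-08-16 route-choice split and the gen-2 crux-only
closes: 13 (2 targets, 7 cruxes, 3 supports, assembly), all typed.

DEFINITION REQUESTS. Existing, wanted here too: defn-InfiniteHardSphereFlow (D1), defn-URegularState
(D2), defn-HardSphereGibbsState (D3) of route
UGibbsRigidity (all landed). NEW 2026-08-15 (KY repair): defn-PalmLocalState (local weak topology on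
laws of marked configurations, Palm law,
rootedLocalState of a finite orbit, the class predicate IsPalmHardSphereState σ e₀) and
defn-InfiniteVolumePesinDefect (posLyapDensity,
infPesinDefect per particle per unit microscopic time, clockChargeDensity; named facts H0–H5). NEW
2026-08-15 (R repair):
defn-HardSphereFluxIntensities (momentum/energy flux intensities incl. collisional transfer,
own-parameter Euler fluxes via
hsPressure 1 ρ θ, fluxDefect, IsSpatiallyErgodic, a.s. empirical density; for PesinGap 13807 /
PesinSaturationRigidityR 13806). Filed right after open (landed, finite-N part):
defn-PesinDefectDensity — for a translation-invariant law ν on PointConfig(ℝ³×ℝ³)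
invariant under the infinite hard-sphere flow, of finite density and specific energy: (a) the
space-time Kolmogorov–Sinai entropy
density h(ν) (entropy per unit time per unit volume, Sinai–Chernov 1982 as cited in Wojtkowski1988
p. 133); (b) the positive-Lyapunov
(unstable-Jacobian) density λ⁺(ν) (thermodynamic limit of Σλ⁺ per unit volume, or the ν-intensity of
log Jᵘ on local unstable
plaques of defn-URegularState); (c) the Pesin defect i(ν) := λ⁺(ν) − h(ν) with the Ruelle inequality
i ≥ 0 as a named fact;
finite-N deliverable first: for a HardSphereFlow on 𝕋³ and a flow-invariant probability law μ,
i_N(μ) := (Σλ⁺(μ) − h_μ(Φ₁))/(N+1)^{4/3}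
via the derivative cocycle of collidePair ∘ freeFlight on the good set (KatokEtAl1986 Part V for
billiard-type maps).

Novelty: Searches (2026-08-15): `lit search --hybrid "large deviations hyperbolic billiards volume lemma
Pesin entropy formula rate function"`
(12 held books: Gaspard1998 pp. 131–152 READ — LD formalism, volume estimate (4.62), escape-rate
formula (4.64); Dorfman1999 p. 196 READ;
BarreiraPesin2023; KipnisLandim1999); `lit galaxy search "volume lemma" --star all` (11 rows;
relevant: Araújo arXiv:math/0607771 LD
bound over non-uniformly expanding base → AraujoPacifico2006); `lit galaxy search "large deviations
for billiards" --star all` (0);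
`lit frontier AtomisticToContinuum --since 2021` (30 rows, none ergodic-theoretic;
CanestrariLiveraniOlla2026 only deterministic hit);
`lit bridges AtomisticToContinuum --cross any` (30 rows, none relevant); `lit search --source all
"large deviations non-uniformly
hyperbolic Rey-Bellet Young"` (searchd rc 75, down); grep of all 30 Theses files of the sub for
Bowen / volume lemma / Pesin (no item
states a volume lemma or a Pesin-defect rate); `ledger negatives` (0); the card's and the triage
refuter's searches (117 cards; Kifer
only as the variational SCGF template in ld-drude / spacetime; Pesin only as rigidity in the parent
card).
Nearest prior art found: Young1990 Thm 1 / Kifer1990 (LD for dynamical systems, upper bound with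
rate h − Σλ⁺ from C² + volume lemma);
LedrappierYoung1985 Thm A (zero defect ⇔ SRB); BowenRuelle1975 (volume lemma, SRB as equilibrium
state); GaspardNicolis1990 and
Gaspard1998 §4.4 (escape rate = Σλ⁺ − h_KS: the Pesin defect  [refs: math/0607771, Gaspard1998, Dorfman1999, BarreiraPesin2023, KipnisLandim1999, AraujoPacifico2006, CanestrariLiveraniOlla2026, Young1990, Kifer1990, LedrappierYoung1985, BowenRuelle1975, GaspardNicolis1990, ReybelletYoung2008, MelbourneNicol2008, BricmontKupiainen1996, KellerLiverani2009]

Barriers (technique_class: thermodynamic-formalism large-deviations volume-lemma): - technique_class: thermodynamic-formalism large-deviations volume-lemma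
- Literature.Barriers.AtomisticToContinuum.BoltzmannHypothesisBarrier: met head-on in a smaller
class and the restriction is DERIVED: the classification is asked only for Pesin-saturating
finite-entropy states (PesinSaturationRigidity), and pricing (UpperVolumeLemma + KiferYoungUpper +
TransferInequality) shows the dynamics cannot afford anything else; the printed kernels (ideal gas
with arbitrary velocity law, hard rods) have no expanding directions — they are the i = 0
COLLISIONLESS phase, excluded from R by the collision/finite-entropy hypotheses and priced
statically (N_P log N ≫ N) when realised as corners inside the gas; honest residue: R(a) is the
barrier's substance in hyperbolic form.
- Literature.Barriers.AtomisticToContinuum.BoltzmannHypothesisBarrierNarrow: the flux-level closure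
it isolates is exactly what R(b) (the Pesin gap: flux defect ≥ δ ⇒ i ≥ c(δ)) quantifies; conceded
that no printed source proves it — the bet is that restricting to i = 0 states makes
Ledrappier–Young/Hopf rigidity available where the bare classification (0779) has none.
- Literature.Barriers.AtomisticToContinuum.MacroErgodicityBarrier: same remark at Euler scaling: its
Definition-1 class of regular stationary states is cut down to the affordable Pesin-saturating
subclass; no Dirichlet form or sector condition is used; oscillator chains (no hyperbolicity) are
outside the claim.
- Literature.Barriers.AtomisticToContinu

History (route lifecycle, newest last):
- 2026-08-16T02:42:33Z · rev 11: restated ZeroExponentPhase (stmt-AtomisticToContinuum-9731) — route-repair (refuted-misstated; crux-attack refuter-rattack-stmt-AtomisticToContinuum-9731-0 2026-08-16T02:33Z, EVIDENCE.md + RepairSketch.lean collisionlessSt (planner-rrefute-AtomisticToContinuum-PesinPric-5265ffb3-0)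
- 2026-08-16T03:15:41Z · rev 13: dropped stmt-AtomisticToContinuum-14091 — route-repair of stmt-9730: withdraw the separate node LimitStatesSaturate (stmt-14091, added 02:55Z by this seat, never rendered — decl imports only arrived at (planner-rrefute-AtomisticToContinuum-PesinPric-c7663470-0)
- 2026-08-16T03:23:13Z · rev 14: restated PricedBoltzmannHypothesis (stmt-AtomisticToContinuum-9730) — route-repair (refuted-misstated; crux-attack refuter-rattack-stmt-AtomisticToContinuum-9730-0 2026-08-16T02:33Z, ATTACK.md §6 C′ + Scratch.lean rooted_ne_bind / (planner-rrefute-AtomisticToContinuum-PesinPric-c7663470-0)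
- 2026-08-16T04:02:40Z · AUTO-CRUX (edit): RelEntropyVanishing — hypotheses of the deciding theorem that nothing in the route derives are cruxes (planner-rbadge-AtomisticToContinuum-PesinPrici-4577c01f-0)
- 2026-08-16T04:40:13Z · rev 26: restated PricingGlue (stmt-AtomisticToContinuum-14564) — route-choice (crux-cap, option (a)) gen-2 step 1/3: restate the pricing glue WITHOUT the EntropyPerParticle antecedent (never used logically; EPP is the line's (planner-rchoice-AtomisticToContinuum-PesinPric-59b22940-g2-0)
- 2026-08-16T05:04:26Z · rev 26: restated Assembly (stmt-AtomisticToContinuum-14527) — route-choice (crux-cap, option (a)) gen-2 step 2/3: Assembly restated to PRIMARY CRUXES → Statement (V → KY → R → EnergyCurrentTails → HydrodynamicLimit), i.e. (planner-rchoice-AtomisticToContinuum-PesinPric-59b22940-g2-0)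
- 2026-08-16T09:25:30Z · rev 46: dropped stmt-AtomisticToContinuum-0769 — route-repair badge gen-3 step 3/3: drop support EntropyToHydro (0769) from this route — discharged inside closes by the landed theorem Theorems.hydrodynamicLimi (planner-rbadge-AtomisticToContinuum-PesinPrici-4577c01f-g3-0)
- 2026-08-24T17:42:54Z · DORMANT — reconciler: no traction for 6.9 d (last activity item-evidence-added at 2026-08-17T18:29:49Z); parked, not closed — `ledger route dormant route-AtomisticToConti (operator:999:4166612)

sub-problem: HydrodynamicLimit · status: dormant · opened planner-plancard-AtomisticToContinuum-Hydrody-6f4b7d8b-0 2026-08-15T13:57:06Z · rev 51 · ledger route-AtomisticToContinuum-PesinPricing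
GENERATED by the gate from the ledger (D-0016/17). Provers cite these decls: `theorem foo : Summit.AtomisticToContinuum.HydrodynamicLimit.Theses.PesinPricing.<Decl> := …` in Summits/AtomisticToContinuum/HydrodynamicLimit/Theorems/<Name>.lean.
-/

namespace Summit.AtomisticToContinuum.HydrodynamicLimit.Theses.PesinPricing

open scoped BigOperators Topology Manifold Classical MeasureTheory ProbabilityTheory Matrix InnerProductSpace ComplexConjugate ContinuousMap
open Filter Set Function TopologicalSpace MeasureTheory

attribute [summit_statement] _root_.HydrodynamicLimit

/-- item stmt-AtomisticToContinuum-0766 · target (kind.auto-crux: conjecture-grade) · rank 0 · open · by planner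
why it might fail: Entropy production ≥ cN before the first shock for some smooth data kills every relative-entropy route; or OVY limit states are zero-defect yet non-Gibbs (¬PesinSaturationRigidityR), leaving the one-block step without an ergodic theorem.
sources: OllaVaradhanYau1993, Yau1991, Spohn1991, KipnisLandim1999
[target] X_RE: for all continuous profiles ∃ σ₀ ∀ σ<σ₀ ∀ classical hs-Euler solutions on [0,T) ∀
flows: the initial local Gibbs laws are probability measures and, if their fields converge at t=0,
then ∀ t<T ∃ activity profile a_t such that the reference local Gibbs law (a_t, u_t, θ_t) is a
probability measure whose empirical density/momentum/energy fields concentrate exponentially (≤ C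
e^{-(N+1)/C}) around (ρ,ρu,E)(t), and klDiv(lawAt Φ_N (localGibbs a₀u₀θ₀) t ‖ localGibbs a_t u_t
θ_t)/(N+1) → 0. Yau1991; OllaVaradhanYau1993 Thm 1.1 (with noise). -/
@[route_item "route-AtomisticToContinuum-PesinPricing"]
def RelEntropyVanishing : Prop :=
  ∀ (a₀ θ₀ : Literature.MathematicalPhysics.KineticTheory.T3 → ℝ) (u₀ : Literature.MathematicalPhysics.KineticTheory.T3 → Literature.MathematicalPhysics.KineticTheory.V3), Continuous a₀ → Continuous θ₀ → Continuous u₀ → (∀ x, 0 < a₀ x) → (∀ x, 0 < θ₀ x) → ∃ σ₀ : ℝ, 0 < σ₀ ∧ ∀ σ : ℝ, 0 < σ → σ < σ₀ → ∀ (T : ℝ) (ρ θ : ℝ → Literature.MathematicalPhysics.KineticTheory.T3 → ℝ) (u : ℝ → Literature.MathematicalPhysics.KineticTheory.T3 → Literature.MathematicalPhysics.KineticTheory.V3), Literature.MathematicalPhysics.KineticTheory.IsHardSphereEulerSolution σ T ρ u θ → ∀ Φ : (N : ℕ) → Literature.Analysis.FluidPDE.HardSphereFlow (Literature.Analysis.FluidPDE.Torus.geometry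 (Fin 3)) (Literature.MathematicalPhysics.KineticTheory.hsDiameter σ N) (N + 1), (∀ N, MeasureTheory.IsProbabilityMeasure (Literature.MathematicalPhysics.KineticTheory.localGibbsLaw σ a₀ u₀ θ₀ N (Φ N))) ∧ (Literature.MathematicalPhysics.KineticTheory.TendstoHydroFieldsAt (fun N => Literature.MathematicalPhysics.KineticTheory.localGibbsLaw σ a₀ u₀ θ₀ N (Φ N)) Φ ρ u θ 0 → ∀ t ∈ Set.Ico 0 T, ∃ a : Literature.MathematicalPhysics.KineticTheory.T3 → ℝ, (∀ N, MeasureTheory.IsProbabilityMeasure (Literature.MathematicalPhysics.KineticTheory.localGibbsLaw σ a (u t) (θ t) N (Φ N))) ∧ (∀ χ : Literature.MathematicalPhysics.KineticTheory.T3 → ℝ, Continuous χ → ∀ δ : ℝ, 0 < δ → ∃ C : ℝ, 0 < C ∧ ∀ N : ℕ, Literature.MathematicalPhysics.KineticTheory.localGibbsLaw σ a (u t) (θ t) N (Φ N) {z | δ < |Literature.MathematicalPhysics.KineticTheory.empiricalDensityField z χ - ∫ x, χ x * ρ t x|} ≤ ENNReal.ofReal (C * Real.exp (-(C⁻¹ *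 (N + 1)))) ∧ Literature.MathematicalPhysics.KineticTheory.localGibbsLaw σ a (u t) (θ t) N (Φ N) {z | δ < ‖Literature.MathematicalPhysics.KineticTheory.empiricalMomentumField z χ - ∫ x, (χ x * ρ t x) • u t x‖} ≤ ENNReal.ofReal (C * Real.exp (-(C⁻¹ * (N + 1)))) ∧ Literature.MathematicalPhysics.KineticTheory.localGibbsLaw σ a (u t) (θ t) N (Φ N) {z | δ < |Literature.MathematicalPhysics.KineticTheory.empiricalEnergyField z χ - ∫ x, χ x * Literature.MathematicalPhysics.KineticTheory.totalEnergyDensity (ρ t x) (u t x) (θ t x)|} ≤ ENNReal.ofReal (C * Real.exp (-(C⁻¹ * (N + 1))))) ∧ Filter.Tendsto (fun N : ℕ => InformationTheory.klDiv ((Φ N).lawAt (Literature.MathematicalPhysics.KineticTheory.localGibbsLaw σ a₀ u₀ θ₀ N (Φ N)) t) (Literature.MathematicalPhysics.KineticTheory.localGibbsLaw σ a (u t) (θ t) N (Φ N)) / ((N : ENNReal) + 1)) Filter.atTop (nhds 0))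

/-- item stmt-AtomisticToContinuum-9426 · crux · rank 2 · open · by planner
why it might fail: The tube measure must factor over collisions with O(1) distortion PER COLLISION uniformly in N (6N dims): earlier grazing/near-simultaneous collisions may focus the conditional law of later impact offsets below scale ε²/(|g|τ⁺); no N-uniform growth lemma exists even for N discs (BalintEtAl2002).
sources: Young1990, BowenRuelle1975, ChernovDolgopyat2009, BalintEtAl2002, SinaiChernov1987, VanzonVanbeijerenDellago1998
[crux] N-UNIFORM UPPER VOLUME LEMMA (card crux 1, global form). There is σ₀ such that for σ < σ₀ and
θe > 0 there is C with, for ALL N, all hard-sphere flows Φ of N+1 spheres of diameter ε = ε_N on 𝕋³,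
all windows t₁ < t₂ and G_N-a.e. z (G_N = localGibbsLaw σ 1 0 θe, the invariant homogeneous
canonical Gibbs law): G_N{z′ : every particle of Φ_s z′ stays within torus distance ε/16 of the same
particle of Φ_s z for all s ∈ [t₁,t₂]} ≤ exp(C(N+1) + C·K − Λ) · G_N{z′ : at time t₁ positions
within ε/16 and velocities within ε/(8·(first collision time of that particle after t₁, capped at
t₂, minus t₁))}, where K = number of collisions of the orbit of z in [t₁,t₂] and Λ = Σ over its
NON-GRAZING collisions (|cos φ| ≥ 1/2, i.e. ε|g| ≤ 2|⟨x_i − x_j, g⟩|) of log(1 + |g|·τ⁺/ε), g the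
relative velocity of the pair and τ⁺ the time to the next collision involving either partner (capped
at t₂). One transverse power only and τ⁺ cut at either partner's next collision are deliberate
undercharges (true clock-model exponent: 2 per collision); e^{C·K} absorbs O(1) per collision,
e^{C(N+1)} the first/last flights. [difficulty: L] -/
@[route_item "route-AtomisticToContinuum-PesinPricing", crux]
def UpperVolumeLemma : Prop :=
  ∃ σ₀ : ℝ, 0 < σ₀ ∧ ∀ σ : ℝ, 0 < σ → σ < σ₀ → ∀ θe : ℝ, 0 < θe → ∃ C : ℝ, ∀ (N : ℕ) (Φ : Literature.Analysis.FluidPDE.HardSphereFlow (Literature.Analysis.FluidPDE.Torus.geometry (Fin 3)) (Literature.MathematicalPhysics.KineticTheory.hsDiameter σ N) (N + 1)) (t₁ t₂ : ℝ), t₁ < t₂ → ∀ᵐ z ∂(Literature.MathematicalPhysics.KineticTheory.localGibbsLaw σ (fun _ => 1) (fun _ => 0) (fun _ => θe) N Φ), (let ε : ℝ := Literature.MathematicalPhysics.KineticTheory.hsDiameter σ N; let G := Literature.Analysis.FluidPDE.Torus.geometry (Fin 3); let μ := Literature.MathematicalPhysics.KineticTheory.localGibbsLaw σ (fun _ =>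 1) (fun _ => 0) (fun _ => θe) N Φ; let γ : ℝ → Literature.Analysis.FluidPDE.Config (N + 1) (Fin 3) Literature.MathematicalPhysics.KineticTheory.T3 := fun s => Φ.flow s z; let nextColl : ℝ → Fin (N + 1) → Fin (N + 1) → ℝ := fun τ i j => sInf ({s : ℝ | τ < s ∧ ∃ k l : Fin (N + 1), k ≠ l ∧ (k = i ∨ k = j) ∧ γ s ∈ Literature.Analysis.FluidPDE.contactSet G (N + 1) ε k l} ∪ {t₂}); let firstColl : Fin (N + 1) → ℝ := fun i => sInf ({s : ℝ | t₁ < s ∧ ∃ l : Fin (N + 1), i ≠ l ∧ γ s ∈ Literature.Analysis.FluidPDE.contactSet G (N + 1) ε i l} ∪ {t₂}); let Λ : ℝ := ∑ᶠ τ ∈ Literature.Analysis.FluidPDE.collisionTimes G ε γ ∩ Set.Icc t₁ t₂, ∑ i : Fin (N + 1), ∑ j : Fin (N + 1), (if i < j ∧ γ τ ∈ Literature.Analysis.FluidPDE.contactSet G (N + 1) ε i j ∧ ε * ‖(γ τ i).2 - (γ τ j).2‖ ≤ 2 * |inner ℝ (G.sepVec (γ τ i).1 (γ τ j).1) ((γ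 τ i).2 - (γ τ j).2)| then Real.log (1 + ‖(γ τ i).2 - (γ τ j).2‖ * (nextColl τ i j - τ) / ε) else 0); let K : ℝ := (Literature.Analysis.FluidPDE.numCollisions G ε γ t₁ t₂ : ℝ); μ {z' | ∀ s ∈ Set.Icc t₁ t₂, ∀ i : Fin (N + 1), Literature.Analysis.FluidPDE.Torus.euclidDist (Φ.flow s z' i).1 (γ s i).1 ≤ ε / 16} ≤ ENNReal.ofReal (Real.exp (C * (N + 1) + C * K - Λ)) * μ {z' | ∀ i : Fin (N + 1), Literature.Analysis.FluidPDE.Torus.euclidDist (Φ.flow t₁ z' i).1 (γ t₁ i).1 ≤ ε / 16 ∧ ‖(Φ.flow t₁ z' i).2 - (γ t₁ i).2‖ ≤ ε / (8 * (firstColl i - t₁))})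

/-- item stmt-AtomisticToContinuum-13790 · crux · rank 3 · open · by planner
why it might fail: Young/Kifer fix a compact system as T→∞; here 6N dims and time grow together (≍N^{1/3} collisions/particle): counting must localise in space with o(1) boundary entropy per particle (only CML precedents); closed 𝒜 disjoint from 𝓛 need infinite dynamics on non-Gibbs limit laws (Alexander1976: Gibbs).
sources: Young1990, Kifer1990, OllaVaradhanYau1993, GeorgiiZessin1993, Alexander1976, BricmontKupiainen1996
[crux] KIFER–YOUNG UPPER BOUND IN THE JOINT LIMIT — REPAIRED STATEMENT C′ of KiferYoungUpper
stmt-AtomisticToContinuum-9728 (rank 3; restated 2026-08-15 after crux-attacks gen-0/gen-2 —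
refuted-misstated W1 vacuity, W2/W2′ frame & caps, W3 normalisation, EVIDENCE.md §5/EVIDENCE2.md §8
there; INFORMAL until defn-PalmLocalState, defn-InfiniteVolumePesinDefect land). SETTING: d = 3, 0 <
σ < σ₀, θe > 0, energy cap e₀ > 0; N+1 spheres of diameter ε = hsDiameter σ N on 𝕋³, any
HardSphereFlow Φ_N; G_N := localGibbsLaw σ 1 0 θe N Φ_N (invariant: GibbsInvariance); macroscopic
window t₁ < t₂; 𝖤(z) := Σ_i |v_i|²/2 (conserved). ROOTED LOCAL STATE R_N(z) := [(N+1)(t₂−t₁)]⁻¹ Σ_i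
∫_{t₁}^{t₂} δ(localConfig (Torus.geometry (Fin 3)) ε (Φ_s z i).1 (Φ_s z)) ds — the configuration
seen from particle i at time s (root at the origin, positions ×ε⁻¹ so unit hard core, velocities
kept), averaged over particles and times: a probability law on PointConfig(ℝ³×ℝ³). TOPOLOGY: local
weak (test functions = bounded continuous F depending only on the configuration in a bounded
window); 𝒜 ranges over ALL closed sets of probability laws — no invariance built into 𝒜. CLASS
𝓛(σ,e₀): laws Q with a particle at the origin -/
@[route_item "route-AtomisticToContinuum-PesinPricing", crux]
def KiferYoungUpperR : Prop :=
  ∃ σ₀ : ℝ, 0 < σ₀ ∧ ∀ σ : ℝ, 0 < σ → σ < σ₀ → ∀ θe : ℝ, 0 < θe → ∀ e₀ : ℝ, 0 < e₀ → ∃ c : ℝ, 0 < c ∧ ∀ t₁ t₂ : ℝ, t₁ < t₂ → ∀ (Φ : (N : ℕ) → Literature.Analysis.FluidPDE.HardSphereFlow (Literature.Analysis.FluidPDE.Torus.geometry (Fin 3)) (Literature.MathematicalPhysics.KineticTheory.hsDiameter σ N) (N + 1)) (𝒜 : Set (MeasureTheory.Measure (Literature.Analysis.FunctionSpaces.PointConfig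 (Literature.MathematicalPhysics.KineticTheory.V3 × Literature.MathematicalPhysics.KineticTheory.V3)))), Literature.Analysis.FunctionSpaces.PointConfig.IsLocalWeakClosed 𝒜 → ∀ r : ℝ, ENNReal.ofReal r < (⨅ (P : MeasureTheory.Measure (Literature.Analysis.FunctionSpaces.PointConfig (Literature.MathematicalPhysics.KineticTheory.V3 × Literature.MathematicalPhysics.KineticTheory.V3))) (Ψ : Literature.Analysis.FluidPDE.InfiniteHardSphereFlow (Fin 3) 1) (_ : MeasureTheory.IsProbabilityMeasure P ∧ Literature.Analysis.FluidPDE.IsTranslationInvariant P ∧ Literature.Analysis.FluidPDE.intensity P = ENNReal.ofReal (σ ^ 3) ∧ (∀ᵐ ω ∂P, Literature.Analysis.FluidPDE.IsHardCore 1 ω) ∧ Ψ.IsAEDefined P ∧ Ψ.IsStationary P ∧ ∫⁻ ω, Literature.Analysis.FluidPDE.rootKineticEnergy ω ∂(Literature.Analysis.FluidPDE.palmLaw P) ≤ ENNReal.ofReal e₀ ∧ Literature.Analysis.FluidPDE.palmLaw P ∈ 𝒜), Literature.Dynamics.Billiards.infPesinDefect Ψ P) → ∀ᶠ N : ℕ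 in Filter.atTop, Literature.MathematicalPhysics.KineticTheory.localGibbsLaw σ (fun _ => 1) (fun _ => 0) (fun _ => θe) N (Φ N) {z | (∑ i : Fin (N + 1), ‖(z i).2‖ ^ 2 / 2) ≤ e₀ * ((N : ℝ) + 1) ∧ Literature.Analysis.FluidPDE.rootedLocalState (Φ N) z t₁ t₂ ∈ 𝒜} ≤ ENNReal.ofReal (Real.exp (-(c * r * ((N : ℝ) + 1) ^ (4 / 3 : ℝ) * (t₂ - t₁))))

/-- item stmt-AtomisticToContinuum-13806 · crux · rank 4 · open · by planner
why it might fail: Infinite-volume Ledrappier–Young is unprinted (LY is compact, finite-dim); a colliding zero-defect conspiracy — a stationary spatially-ergodic regular dilute NON-Gibbs state with h = λ⁺ — refutes it and URigidity at once; H1 i(Gibbs)=0 is unproved: {i=0} may restrict nothing (≡ 0779) or be empty.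
sources: LedrappierYoung1985, NachtergaeleYau2003, OllaVaradhanYau1993, BarreiraPesin2023, PesinSinai1982, KellerLiverani2009
[crux] PESIN SATURATION ⇒ GIBBS — REPAIRED STATEMENT C′(a) of PesinSaturationRigidity
stmt-AtomisticToContinuum-9729 (rank 4; restated 2026-08-15 after crux-attacks gen-1/gen-2,
refuted-misstated: holes δ_∅ / z = 0, density-on-average mixtures, reference state R5 — ATTACK.md
§2, ATTACK-G2.md §§2–4, RepairSketch.lean RepairedA/RepairedAMixture there; part (b) is now the
separate item PesinGap). INFORMAL until defn-InfiniteVolumePesinDefect lands (the ONLY owed object;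
all else is in the tree). SETTING (d = 3, unit diameter; NOT general d — hard rods d = 1 are an
integrable counterexample): Φ : InfiniteHardSphereFlow (Fin 3) 1 with Φ.IsEquilibriumFlow
(Alexander1976); ν with RegularStationaryState Φ ν (KineticTheory.RegularStationaryState:
probability, IsTranslationInvariant, Φ.IsAEDefined, Φ.IsStationary, density ν < ∞,
kineticEnergyDensity ν < ∞, IsHardSphereRegular 1 ν = entropy-regular w.r.t. SOME Gibbs state
g_{z,β,u}, not g_{1,0,1}); h(ν) := Literature.Dynamics.Billiards.entropyDensity Φ ν (space-time KS
entropy density, in tree); λ⁺(ν) := positive-Lyapunov (unstable-Jacobian) density per unit volume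
per unit microscopic time and i(ν) := λ⁺(ν) ∸ h(ν) — defn-InfiniteVolumePesinD -/
@[route_item "route-AtomisticToContinuum-PesinPricing", crux]
def PesinSaturationRigidityR : Prop :=
  ∃ η₀ : ℝ, 0 < η₀ ∧ ∀ (Φ : Literature.Analysis.FluidPDE.InfiniteHardSphereFlow (Fin 3) 1), Φ.IsEquilibriumFlow → ∀ ν : MeasureTheory.Measure (Literature.Analysis.FunctionSpaces.PointConfig (Literature.MathematicalPhysics.KineticTheory.V3 × Literature.MathematicalPhysics.KineticTheory.V3)), Literature.MathematicalPhysics.KineticTheory.RegularStationaryState Φ ν → (∀ A : Set (Literature.Analysis.FunctionSpaces.PointConfig (Literature.MathematicalPhysics.KineticTheory.V3 × Literature.MathematicalPhysics.KineticTheory.V3)), MeasurableSet A → (∀ a : Literature.MathematicalPhysics.KineticTheory.V3, Literature.Analysis.FunctionSpaces.PointConfig.translate ((a, 0) : Literature.MathematicalPhysics.KineticTheory.V3 × Literature.MathematicalPhysics.KineticTheory.V3) ⁻¹' A = A) → ν A = 0 ∨ ν A = 1) → 0 < Literature.MathematicalPhysics.KineticTheory.PointProcess.density ν → Literature.MathematicalPhysics.KineticTheory.PointProcess.density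 ν < ENNReal.ofReal η₀ → Literature.Dynamics.Billiards.infPesinDefect Φ ν = 0 → ∃ (z β : ℝ) (u : Literature.MathematicalPhysics.KineticTheory.V3), 0 < z ∧ 0 < β ∧ Literature.Analysis.FluidPDE.IsHardSphereGibbs 1 z β u ν

/-- item stmt-AtomisticToContinuum-9235 · crux · rank 7 · open · by planner
why it might fail: Energy is conserved only globally and the O(N) entropy budget is blind to cubic tails: a vanishing fraction of spheres could carry speeds ≍ N^{1/2} pre-shock; no maximum principle / N-uniform Povzner estimate for deterministic hard spheres is known (OVY modified the kinetic energy instead).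
sources: OllaVaradhanYau1993, NachtergaeleYau2003, Spohn1991, Literature.Barriers.AtomisticToContinuum.HighMomentumCutoffBarrierNarrow
[crux] UNIFORM INTEGRABILITY OF THE CUBIC ENERGY CURRENT BEFORE THE FIRST SHOCK (shared typed crux
stmt-AtomisticToContinuum-3655 of route KineticWindows; the card's "cubic UI" conjunct X_T): for
continuous profiles ∃ σ₀ ∀ σ ∈ (0,σ₀) ∀ classical hs-Euler solutions on [0,T) ∀ flow families, if
the local Gibbs fields converge at t = 0 then ∀ t < T ∀ ε > 0 ∃ M ∃ N₀ ∀ N ≥ N₀ ∀ s ∈ [0,t]: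
E[(N+1)⁻¹ Σ_i |v_i(s)|³ 1{|v_i(s)| > M}] ≤ ε. Needed here only for the energy equation (heat flux
and (E+p)u): the quadratic momentum closure needs no tail input in this route (energy conservation +
the o(N) entropy bootstrap exclude sparse energy concentration, whose local-Gibbs cost is
extensive), but cubic mass on a vanishing fraction of particles has SUB-extensive cost. [difficulty:
open-problem] -/
@[route_item "route-AtomisticToContinuum-PesinPricing", crux]
def EnergyCurrentTails : Prop :=
  ∀ (a₀ θ₀ : Literature.MathematicalPhysics.KineticTheory.T3 → ℝ) (u₀ : Literature.MathematicalPhysics.KineticTheory.T3 → Literature.MathematicalPhysics.KineticTheory.V3), Continuous a₀ → Continuous θ₀ → Continuous u₀ → (∀ x, 0 < a₀ x) → (∀ x, 0 < θ₀ x) → ∃ σ₀ : ℝ, 0 < σ₀ ∧ ∀ σ : ℝ, 0 < σ → σ < σ₀ → ∀ (T : ℝ) (ρ θ : ℝ → Literature.MathematicalPhysics.KineticTheory.T3 → ℝ) (u : ℝ → Literature.MathematicalPhysics.KineticTheory.T3 → Literature.MathematicalPhysics.KineticTheory.V3), Literature.MathematicalPhysics.KineticTheory.IsHardSphereEulerSolution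 σ T ρ u θ → ∀ Φ : (N : ℕ) → Literature.Analysis.FluidPDE.HardSphereFlow (Literature.Analysis.FluidPDE.Torus.geometry (Fin 3)) (Literature.MathematicalPhysics.KineticTheory.hsDiameter σ N) (N + 1), Literature.MathematicalPhysics.KineticTheory.TendstoHydroFieldsAt (fun N => Literature.MathematicalPhysics.KineticTheory.localGibbsLaw σ a₀ u₀ θ₀ N (Φ N)) Φ ρ u θ 0 → ∀ t ∈ Set.Ico 0 T, ∀ ε : ℝ, 0 < ε → ∃ M : ℝ, ∃ N₀ : ℕ, ∀ N : ℕ, N₀ ≤ N → ∀ s ∈ Set.Icc 0 t, ∫⁻ z, ENNReal.ofReal (((N : ℝ) + 1)⁻¹ * ∑ i : Fin (N + 1), Set.indicator {v : Literature.MathematicalPhysics.KineticTheory.V3 | M < ‖v‖} (fun v => ‖v‖ ^ 3) (((Φ N).flow s z i).2)) ∂(Literature.MathematicalPhysics.KineticTheory.localGibbsLaw σ a₀ u₀ θ₀ N (Φ N)) ≤ ENNReal.ofReal ε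

/-- item stmt-AtomisticToContinuum-14419 · target · rank 9 · open · by planner
why it might fail: DefectRate (l.s.c. of λ⁺ on 𝓛(σ,e₀)) may fail without tempered collision statistics; infinite dynamics on non-Gibbs limit states is open; a colliding zero-defect regular dilute NON-Gibbs limit state (¬13806) kills (iv); intensity = σ³ needs no velocity mass loss.
sources: OllaVaradhanYau1993, Young1990, Kifer1990, KipnisLandim1999, Alexander1976, NachtergaeleYau2003
[support] THE PRICED BOLTZMANN PROPERTY OF THE STATES THAT OCCUR — typed 1:1 repaired restatement of
the informal pricing glue stmt-AtomisticToContinuum-9730 (refuted-misstated 2026-08-16T02:33Z: L0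
antecedents named the dropped 9728/9729; L1 'tag a typical particle, recentre' makes local limits
ROOTED/Palm, for which 'Gibbs mixture' is false; L2 the Gibbs conclusion needs a per-component
density bound < η₀ that no antecedent gives — the static O(N) budget affords dense
locally-equilibrated patches on a particle fraction f* ≈ 0.25–0.31 at σ³ = 0.01; slips: energy cut
e₀, direction of the l.s.c. argument; refuter ATTACK.md §6 C′, Scratch.lean). FRAME (L1): stated for
OVY's UN-ROOTED space–time averaged local law Q^{ε_N} over [0,T₀] (uniform zoom point; tree
IsOVYLimitState) whose limit points are translation-invariant laws; the particle-rooted R_N of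
KiferYoungUpperR 13790 is its Palm version and lives inside the proof. CLAIM: ∃η₀>0 ∀ continuous
positive profiles ∃σ₀ ∀σ<σ₀ ∃e₀ ∀T₀>0 ∀flows ∀μ OVY limit state: (i) intensity μ = σ³,
kineticEnergyDensity μ ≤ e₀; (ii) μ entropy-regular w.r.t. a DILUTE translation-invariant Gibbs
state g_{z,β,0}, 0 < z ≤ 2σ³ (thermodynamic limit of the i -/
@[route_item "route-AtomisticToContinuum-PesinPricing"]
def PricedBoltzmannProperty : Prop :=
  ∃ η₀ : ENNReal, 0 < η₀ ∧ ∀ (a₀ θ₀ : Literature.MathematicalPhysics.KineticTheory.T3 → ℝ) (u₀ : Literature.MathematicalPhysics.KineticTheory.T3 → Literature.MathematicalPhysics.KineticTheory.V3), Continuous a₀ → Continuous θ₀ → Continuous u₀ → (∀ x, 0 < a₀ x) → (∀ x, 0 < θ₀ x) → ∃ σ₀ : ℝ, 0 < σ₀ ∧ ∀ σ : ℝ, 0 < σ → σ < σ₀ → ∃ e₀ : ℝ, ∀ T₀ : ℝ, 0 < T₀ → ∀ (Φ : (N : ℕ) → Literature.Analysis.FluidPDE.HardSphereFlow (Literature.Analysis.FluidPDE.Torus.geometry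 (Fin 3)) (Literature.MathematicalPhysics.KineticTheory.hsDiameter σ N) (N + 1)) (μ : MeasureTheory.Measure (Literature.Analysis.FunctionSpaces.PointConfig (Literature.MathematicalPhysics.KineticTheory.V3 × Literature.MathematicalPhysics.KineticTheory.V3))), Literature.MathematicalPhysics.KineticTheory.IsOVYLimitState σ a₀ θ₀ u₀ T₀ Φ μ → (Literature.Analysis.FluidPDE.intensity μ = ENNReal.ofReal (σ ^ 3) ∧ Literature.MathematicalPhysics.KineticTheory.kineticEnergyDensity μ ≤ ENNReal.ofReal e₀ ∧ (∃ (z β : ℝ) (g : MeasureTheory.Measure (Literature.Analysis.FunctionSpaces.PointConfig (Literature.MathematicalPhysics.KineticTheory.V3 × Literature.MathematicalPhysics.KineticTheory.V3))), 0 < z ∧ z ≤ 2 * σ ^ 3 ∧ 0 < β ∧ Literature.Analysis.FluidPDE.IsHardSphereGibbs 1 z β 0 g ∧ Literature.Analysis.FluidPDE.IsTranslationInvariant g ∧ Literature.MathematicalPhysics.KineticTheory.PointProcess.IsEntropyRegular g μ) ∧ (∃ Φinf : Literature.Analysis.FluidPDE.InfiniteHardSphereFlow (Fin 3) 1, Φinf.IsEquilibriumFlow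 ∧ Φinf.IsTranslationCovariant ∧ Literature.MathematicalPhysics.KineticTheory.RegularStationaryState Φinf μ ∧ Literature.Dynamics.Billiards.infPesinDefect Φinf μ = 0) ∧ (let D : Set (Literature.Analysis.FunctionSpaces.PointConfig (Literature.MathematicalPhysics.KineticTheory.V3 × Literature.MathematicalPhysics.KineticTheory.V3)) := {ω | ∀ᶠ n : ℕ in Filter.atTop, ((Literature.Analysis.FunctionSpaces.PointConfig.count ω (Literature.MathematicalPhysics.KineticTheory.PointProcess.centredBox n ×ˢ (Set.univ : Set Literature.MathematicalPhysics.KineticTheory.V3))) : ENNReal) < η₀ * MeasureTheory.volume (Literature.MathematicalPhysics.KineticTheory.PointProcess.centredBox (d := Fin 3) n)}; μ D ≠ 0 → ∃ (π : MeasureTheory.Measure (ℝ × ℝ × Literature.MathematicalPhysics.KineticTheory.V3)) (κ : ℝ × ℝ × Literature.MathematicalPhysics.KineticTheory.V3 → MeasureTheory.Measure (Literature.Analysis.FunctionSpaces.PointConfig (Literature.MathematicalPhysics.KineticTheory.V3 × Literature.MathematicalPhysics.KineticTheory.V3))), MeasureTheory.IsProbabilityMeasure π ∧ Measurable κ ∧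 (∀ᵐ θ ∂π, 0 ≤ θ.1 ∧ 0 < θ.2.1 ∧ Literature.Analysis.FluidPDE.IsHardSphereGibbs 1 θ.1 θ.2.1 θ.2.2 (κ θ)) ∧ (μ D)⁻¹ • μ.restrict D = π.bind κ))

/-- item stmt-AtomisticToContinuum-14536 · crux · rank 9 · open · by planner
why it might fail: Noiseless OVY is unprinted: the dense-patch cutoff needs the per-dense-particle contribution to ∂ₜH_N bounded after velocity truncation (impulsive collisional transfer, Spohn (3.37)–(3.38)); the pricing output says nothing at density ≥ η₀; EOS inversion needs ρσ³ inside the analyticity radius.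
sources: OllaVaradhanYau1993, Yau1991, KipnisLandim1999, Spohn1991, Ruelle1969, NachtergaeleYau2003
[support] GRONWALL-U — THE OVY / YAU RELATIVE-ENTROPY ARCHITECTURE FOR THE DETERMINISTIC DILUTE
HARD-SPHERE GAS, GIVEN THE PRICED BOLTZMANN PROPERTY AND THE VELOCITY TAILS: PricedBoltzmannProperty
→ EnergyCurrentTails → RelEntropyVanishing (the glue that makes the target reachable from the
route's items; it realises the informal GronwallU stmt-AtomisticToContinuum-5688 of the retired
UGibbsRigidity for THIS line and answers route.target-unreachable and refuter REVIEW.md O4 'put the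
pricing sufficiency on the ledger'). CONTENT (known architecture, OllaVaradhanYau1993 §§2–3 with
KipnisLandim1999 Ch. 6; no noise anywhere): (1) H_N(t) := H(f_t | ψ_t), ψ_t = localGibbsLaw σ a_t
u_t θ_t with a_t the activity profile inverting the hard-sphere equation of state at (ρ,θ)(t)
(statics: existence/continuity of a_t for σ < σ₀ and EXPONENTIAL CONCENTRATION of the empirical
fields under ψ_t by cluster expansion — the 0767/0768-type statics of RelEntropyErgodic, proved
inside as lemmas, not taken as premises); (2) Yau's computation of ∂_t H_N: microscopic currents
(tree vocabulary HardSphereFluxIntensities: kinetic + collisional transfer) against ∇(λ_t); (3)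
VELOCITY TRUNCATION at |v| ≤ M using En -/
@[route_item "route-AtomisticToContinuum-PesinPricing", crux]
def GronwallU : Prop :=
  PricedBoltzmannProperty → EnergyCurrentTails → RelEntropyVanishing

-- earlier PricingGlue (stmt-AtomisticToContinuum-14564, replaced 2026-08-16T04:40:13Z -> stmt-AtomisticToContinuum-14643): retired by None — UpperVolumeLemma → KiferYoungUpperR → PesinSaturationRigidityR → EntropyPerParticle → PricedBoltzmannProperty
/-- item stmt-AtomisticToContinuum-14643 · crux · rank 9 · open · by planner
why it might fail: Step (4) DefectRate: i need not be a good rate function on 𝓛(σ,e₀) — bounded-defect limit laws may carry no infinite dynamics (𝓛 not closed) or λ⁺ may drop at grazing-heavy limits — so KY's bound never localises to i(μ)=0; step (8): ergodic components of a stationary state need not be stationary.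
sources: OllaVaradhanYau1993, Young1990, Kifer1990, Mecke1967, Alexander1976, LedrappierYoung1985
[crux] PRICING GLUE — THE THREE MECHANISM CRUXES IMPLY THE PRICED BOLTZMANN PROPERTY:
UpperVolumeLemma → KiferYoungUpperR → PesinSaturationRigidityR → PricedBoltzmannProperty (restated
2026-08-16 by the route-choice seat gen-2: the antecedent EntropyPerParticle of the first filing
stmt-AtomisticToContinuum-14564 is REMOVED — it was never used logically, it is the line's tooth and
rides as a support — so that the deciding theorem `closes` can take V, KY, R and this glue as
hypotheses and stay at the crux cap; kind crux from the same edit: D-0027 §2.1, every unproved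
hypothesis of `closes` is a crux, and this node honestly carries the unprinted DefectRate step).
GibbsInvariance (9239) and TransferInequality (9512) are USED but, being provable-now supports, are
not carried as antecedents (the implication is claimed with them as theorems). CONTENT = the 'PROOF
ROUTE' paragraph of PricedBoltzmannProperty (14419) made an item: (1) ENERGY CUT — Cramér under the
Maxwellian velocities of G_N: G_N{𝖤 > e₀(N+1)} ≤ e^{−C′(N+1)} for e₀ = e₀(θe,C′); (2) TRANSFER AT
TIME 0 — TransferInequality (θe > sup θ₀/2): initial events of G_N-probability ≤ e^{−C′(N+1)}, C′ >
C, are negligible under the local -/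
@[route_item "route-AtomisticToContinuum-PesinPricing", crux]
def PricingGlue : Prop :=
  UpperVolumeLemma → KiferYoungUpperR → PesinSaturationRigidityR → PricedBoltzmannProperty

/-- item stmt-AtomisticToContinuum-9427 · support · rank 5 · open · by planner
why it might fail: Wojtkowski1988 (pp. 133–134) gets only ~√N·(rate): cone/Q-form methods measure each collision against the SYSTEM's previous collision (time ~1/(Nν)), not the particle's (~1/ν); an N-uniform bound needs per-particle locality of expansion — the same wall as UpperVolumeLemma.
sources: Wojtkowski1988, SinaiChernov1987, Chernov1997, VanbeijerenEtAl1997, LedrappierYoung1985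
[crux] POSITIVE DYNAMICAL ENTROPY PER PARTICLE PER COLLISION, N-UNIFORM (shared with route
UGibbsRigidity, stmt-AtomisticToContinuum-4276; the teeth of pricing: if the entropy — equivalently,
by the Pesin formula for the smooth invariant law at finite N, the positive-Lyapunov sum — per
collision tended to 0 along N → ∞, the Pesin-defect rate would price nothing): there is σ₀ such that
for σ < σ₀ there is c > 0 with, for all N ≥ 1 and all flows Φ, a finite measurable partition whose
Kolmogorov–Sinai entropy rate under the equilibrium Gibbs law (activity 1, drift 0, temperature 1)
for the macroscopic time-one map Φ₁ is ≥ c (N+1)^{4/3} = c′ × (collisions per unit macroscopic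
time). The averaged shadow of UpperVolumeLemma's expansion half (E_G Λ ≍ (N+1)^{4/3}(t₂−t₁)
log(1/σ³)). [difficulty: L] -/
@[route_item "route-AtomisticToContinuum-PesinPricing"]
def EntropyPerParticle : Prop :=
  ∃ σ₀ : ℝ, 0 < σ₀ ∧ ∀ σ : ℝ, 0 < σ → σ < σ₀ → ∃ c : ℝ, 0 < c ∧ ∀ (N : ℕ) (Φ : Literature.Analysis.FluidPDE.HardSphereFlow (Literature.Analysis.FluidPDE.Torus.geometry (Fin 3)) (Literature.MathematicalPhysics.KineticTheory.hsDiameter σ N) (N + 1)), 1 ≤ N → ∃ (k : ℕ) (P : Fin k → Set (Literature.Analysis.FluidPDE.Config (N + 1) (Fin 3) Literature.MathematicalPhysics.KineticTheory.T3)), (∀ i, MeasurableSet (P i)) ∧ Pairwise (Function.onFun Disjoint P) ∧ (⋃ i, P i) = Set.univ ∧ c * ((N : ℝ) + 1) ^ (4 / 3 : ℝ) ≤ Filter.liminf (fun n : ℕ => (n : ℝ)⁻¹ * ∑ w : Fin n → Fin k, -((Literature.MathematicalPhysics.KineticTheory.localGibbsLaw σ (fun _ => 1) (fun _ => 0) (fun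 _ => 1) N Φ).real (⋂ m : Fin n, (Φ.flow 1)^[m.val] ⁻¹' P (w m)) * Real.log ((Literature.MathematicalPhysics.KineticTheory.localGibbsLaw σ (fun _ => 1) (fun _ => 0) (fun _ => 1) N Φ).real (⋂ m : Fin n, (Φ.flow 1)^[m.val] ⁻¹' P (w m))))) Filter.atTop

/-- item stmt-AtomisticToContinuum-9239 · support · rank 9 · closed · proved by Summit.AtomisticToContinuum.HydrodynamicLimit.Theorems.superextensiveClosureCost_gibbsInvariance_proof @ b2d3e0ae4bc2 (prover) · by planner
sources: Alexander1975, CercignaniIllnerPulvirenti1994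
[support] the homogeneous canonical law localGibbsLaw σ 1 0 θe N Φ is preserved by Φ.flow t for
every t (shared typed support stmt-AtomisticToContinuum-3926 of route SpacetimeExtensivity):
HardSphereFlow.measurePreserving (Liouville) + IsHardSphereTrajectory.configEnergy_eq_holds (energy)
+ good ⊆ hardSphereDomain conull. The invariant reference law of ColdCellsNegligible and of the
transfer of WarmAnisotropyRare. [difficulty: provable-now] -/
@[route_item "route-AtomisticToContinuum-PesinPricing"]
def GibbsInvariance : Prop :=
  ∀ (σ θe : ℝ) (N : ℕ) (Φ : Literature.Analysis.FluidPDE.HardSphereFlow (Literature.Analysis.FluidPDE.Torus.geometry (Fin 3)) (Literature.MathematicalPhysics.KineticTheory.hsDiameter σ N) (N + 1)) (t : ℝ), 0 < θe → MeasureTheory.MeasurePreserving (Φ.flow t) (Literature.MathematicalPhysics.KineticTheory.localGibbsLaw σ (fun _ => 1) (fun _ => 0) (fun _ => θe) N Φ) (Literature.MathematicalPhysics.KineticTheory.localGibbsLaw σ (fun _ => 1) (fun _ => 0) (fun _ => θe) N Φ)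

/-- `GibbsInvariance` holds: proved by `Summit.AtomisticToContinuum.HydrodynamicLimit.Theorems.superextensiveClosureCost_gibbsInvariance_proof` @ b2d3e0ae4bc2. -/
theorem GibbsInvariance_holds : GibbsInvariance := _root_.Summit.AtomisticToContinuum.HydrodynamicLimit.Theorems.superextensiveClosureCost_gibbsInvariance_proof

/-- item stmt-AtomisticToContinuum-9512 · support · rank 9 · closed · proved by Summit.AtomisticToContinuum.HydrodynamicLimit.Theorems.transferInequality_proof @ d0c8299490d5 (prover) · by planner
[support] (stmt-3924 text, provable now) static L² budget localGibbsLaw(S)² ≤ e^{C(N+1)}·G(S).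
[difficulty: provable-now] -/
@[route_item "route-AtomisticToContinuum-PesinPricing"]
def TransferInequality : Prop :=
  ∀ (a₀ θ₀ : Literature.MathematicalPhysics.KineticTheory.T3 → ℝ) (u₀ : Literature.MathematicalPhysics.KineticTheory.T3 → Literature.MathematicalPhysics.KineticTheory.V3), Continuous a₀ → Continuous θ₀ → Continuous u₀ → (∀ x, 0 < a₀ x) → (∀ x, 0 < θ₀ x) → ∀ θe : ℝ, (∀ x, θ₀ x < 2 * θe) → ∃ σ₀ : ℝ, 0 < σ₀ ∧ ∀ σ : ℝ, 0 < σ → σ < σ₀ → ∃ C : ℝ, ∀ (N : ℕ) (Φ : Literature.Analysis.FluidPDE.HardSphereFlow (Literature.Analysis.FluidPDE.Torus.geometry (Fin 3)) (Literature.MathematicalPhysics.KineticTheory.hsDiameter σ N) (N + 1)) (S : Set (Literature.Analysis.FluidPDE.Config (N + 1) (Fin 3) Literature.MathematicalPhysics.KineticTheory.T3)), Literature.MathematicalPhysics.KineticTheory.localGibbsLaw σ a₀ u₀ θ₀ N Φ S ^ 2 ≤ ENNReal.ofReal (Real.exp (C * (N + 1))) * Literature.MathematicalPhysics.KineticTheory.localGibbsLaw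 σ (fun _ => 1) (fun _ => 0) (fun _ => θe) N Φ S

/-- `TransferInequality` holds: proved by `Summit.AtomisticToContinuum.HydrodynamicLimit.Theorems.transferInequality_proof` @ d0c8299490d5. -/
theorem TransferInequality_holds : TransferInequality := _root_.Summit.AtomisticToContinuum.HydrodynamicLimit.Theorems.transferInequality_proof

-- earlier Assembly (stmt-AtomisticToContinuum-14527, replaced 2026-08-16T05:04:26Z -> stmt-AtomisticToContinuum-14653): retired by None — UpperVolumeLemma → KiferYoungUpperR → PricedBoltzmannProperty → TransferInequality → GibbsInvariance → EntropyToHydro → HydrodynamicLimit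
-- earlier Assembly (stmt-AtomisticToContinuum-9240, replaced 2026-08-16T03:31:06Z -> stmt-AtomisticToContinuum-14527): proved by Summit.AtomisticToContinuum.HydrodynamicLimit.Theorems.hydrodynamicLimit_of_relEntropyVanishing — RelEntropyVanishing → _root_.HydrodynamicLimit
-- earlier Assembly (stmt-AtomisticToContinuum-9429, replaced 2026-08-16T03:23:40Z -> stmt-AtomisticToContinuum-9240): retired by None — RelEntropyVanishing → EntropyToHydro → HydrodynamicLimit
/-- item stmt-AtomisticToContinuum-14653 · assembly · rank 1 · open · by planner
sources: KipnisLandim1999, OllaVaradhanYau1993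
[assembly] THE LINE'S PRIMARY CRUXES IMPLY THE STATEMENT (contentful by design, restated 2026-08-16
by the route-choice seat gen-2 to match the crux-only deciding theorem; replaces
stmt-AtomisticToContinuum-14527 `UpperVolumeLemma → KiferYoungUpperR → PricedBoltzmannProperty →
TransferInequality → GibbsInvariance → EntropyToHydro → HydrodynamicLimit`, which carried the
now-derived pricing output and two provable-now supports as antecedents and omitted the
velocity-tail crux): UpperVolumeLemma (V) → KiferYoungUpperR (KY, 13790) → PesinSaturationRigidityR
(R, 13806) → EnergyCurrentTails (9235) → HydrodynamicLimit. It is exactly `closes` with its three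
GLUE CRUXES discharged: PricingGlue (V → KY → R → PricedBoltzmannProperty: energy cut, transfer at
time 0, KY on the cut event, DefectRate, barycentre + flow piecing, Palm inversion, static budget,
dilute part Gibbs by R + ComponentLemma), GronwallU (PricedBoltzmannProperty → EnergyCurrentTails →
RelEntropyVanishing: Yau's relative-entropy Gronwall without noise, velocity truncation, dense-patch
cutoff, one-block through the OVY limit states, virial identification, reference statics) and
EntropyToHydro (RelEntropyVanishing → Hydrodynami -/
@[route_item "route-AtomisticToContinuum-PesinPricing"]
def Assembly : Prop :=
  UpperVolumeLemma → KiferYoungUpperR → PesinSaturationRigidityR → EnergyCurrentTails → HydrodynamicLimit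

-- records of items no longer active in this route (dropped / restated):
-- earlier EntropyToHydro (stmt-AtomisticToContinuum-9428, replaced 2026-08-15T16:31:19Z -> stmt-AtomisticToContinuum-0769): retired by None — RelEntropyVanishing → HydrodynamicLimit
-- earlier PricedBoltzmannHypothesis (stmt-AtomisticToContinuum-9730, replaced 2026-08-16T03:23:13Z -> stmt-AtomisticToContinuum-14419): retired by None — [support] THE PRICING GLUE — BOLTZMANN HYPOTHESIS FOR THE STATES THAT OCCUR (card pesin-defect-prices-u-regularity §Assembly; rank 9; INFORMAL until the definition requests land). CLAIM: GibbsInvariance (stmt-AtomisticToContinuum-3926) ∧ TransferIn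
-- earlier ZeroExponentPhase (stmt-AtomisticToContinuum-9731, replaced 2026-08-16T02:42:33Z -> stmt-AtomisticToContinuum-14089): retired by None — [support] ZERO-EXPONENT CLASSIFICATION (card pesin-defect-prices-u-regularity support 5; rank 9; the pathwise half is typable over Literature.Analysis.FluidPDE.IsHardSphereTrajectory once a two-body derivative lemma for collidePair ∘ freeFlight is in the l

/-! D-0027 §2.1 — DECIDING THEOREM (planner-authored via `route open/edit --closes-file`; by planner-rrepair-AtomisticToContinuum-PesinPric-683d8525-0 2026-08-16T23:28:33Z):
its hypotheses are this route's items and its conclusion the sub-problem Statement (glue_lint), and it elaborates with this file. -/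

/-- D-0027 §2.1 deciding theorem of route PesinPricing (pure logic), crux-only form, re-elaborated
after the 2026-08-16 statement re-type (p126922: `HydrodynamicLimit` is now the PACKING-GUARDED
d = 3 hard-sphere Euler limit): the three mechanism cruxes UpperVolumeLemma, KiferYoungUpperR,
PesinSaturationRigidityR give the pricing output PricedBoltzmannProperty through the glue crux
PricingGlue; the shared velocity-tail crux EnergyCurrentTails and the one-block Gronwall glue crux
GronwallU turn it into the typed target RelEntropyVanishing, derived inside; the entropy-inequality
step from RelEntropyVanishing to the UNGUARDED Literature conjecture
`Literature.MathematicalPhysics.KineticTheory.HydrodynamicLimit` is the LANDED theorem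
Theorems.hydrodynamicLimit_of_relEntropyVanishing (p85039, file TwoClocksEntropyToHydro.lean), and
the re-typed (weaker) sub-problem Statement follows by the registry bridge
`HydrodynamicLimit.of_unguarded` (Statement.lean, p126922) — the packing guard
`∀ t ∈ Ico 0 T, ∀ x, ρ t x * σ ^ 3 < η₀` is an extra hypothesis this route's scheme simply
discards (it proves the unguarded LLN for every classical solution), so no new item is needed.
Hypotheses are exactly the six cruxes of the route and nothing else. -/
@[closes "route-AtomisticToContinuum-PesinPricing"] theorem closes (hV : UpperVolumeLemma) (hKY : KiferYoungUpperR) (hR : PesinSaturationRigidityR)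
    (hPG : PricingGlue) (hT : EnergyCurrentTails) (hG : GronwallU) :
    _root_.HydrodynamicLimit :=
  _root_.HydrodynamicLimit.of_unguarded
    (Summit.AtomisticToContinuum.HydrodynamicLimit.Theorems.hydrodynamicLimit_of_relEntropyVanishing
      (hG (hPG hV hKY hR) hT))

end Summit.AtomisticToContinuum.HydrodynamicLimit.Theses.PesinPricing
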